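import Summits.AnomalousDissipation.AnomalousDissipation.Theses.NeutralTaylorWaves
import Literature.Analysis.FluidPDE.SteadyNSLatticePersistenceDrift

/-!
# Crux `NewtonRealisation` (stmt-AnomalousDissipation-16315, route NeutralTaylorWaves, rank 4) — line `Sketch`

Lead skeleton (prover-line-stmt-AnomalousDissipation-16315-0, 2026-08-17), built on the kernel-checked force-side
composition of `Cruxes/NewtonRealisation/SketchIdeator1R1.lean` (card `force-side-persistence` ≡ lever of
`lattice-fredholm-persistence`): the crux follows BY NAME from

* the TRANSFER `C⁺ = QuantBorderedPersistence` (quantitative bordered persistence of an exact drifted steady state under an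
  `O(P⁻²)` change of force, fixed viscosity), PROVED here (`quantPersistenceCore_of_lattice`, the quantitative bordered twin
  of `SteadyLatticeDrift.steadyPersistsInLeaf_of_nondeg`) from three LATTICE stubs — `stub_latticeDictionary` (base state ∣
  synthesis ∣ forces), `stub_aprioriTransfer` (Parseval transfer of the crux's bordered `L²` bound; the heart),
  `stub_ellipticDensity` (`W`-norm upgrade + density) — and the two abstract stubs below;
* `stub_borderedFredholm` — abstract bordered Fredholm alternative on `E × ℝ` (Mathlib only);
* `stub_quadraticNewton` — abstract quantitative Newton step for the quadratic drifted steady map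
  `Φ(x, β) = (a x − β D x + B(x,x) − F, ℓ(x − x₀))` on `E × ℝ` (Mathlib + `exists_zero_near_of_simplifiedNewton`);
* `stub_calculusFacts` — two elementary torus-calculus facts;
* `stub_driftAbsorption` — VERBATIM the registered stub 3 of `Lines/birth.lean` (Galilean bookkeeping).

Composition `NewtonRealisation_of` (no `sorry` of its own; hypotheses = the name-keyed aliases `__Registered.stub_*`,
textually the stub signatures): selection along the nonresonant subsequence with `K := 4k(K₀+1)+3` (Ideator 1's
`perStep` + power counting, unchanged).

Disproof used: none exists for this crux (no `Disproof.lean`, no `Theorems/NewtonRealisation/Negative/*`, 2026-08-17).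
Reshape 1 (2026-08-17T13:10Z): `stub_quantPersistenceCore` replaced by the three lattice stubs + `quantPersistenceCore_of_lattice`.
Hardest stub: `stub_aprioriTransfer` (held by the lead). Landed so far: `stub_borderedFredholm` (p158893), `stub_driftAbsorption` (p159047).
-/

set_option linter.dupNamespace false

noncomputable section

open scoped BigOperators Topology ENNReal NNReal InnerProductSpace ComplexConjugate
open Filter Set Function MeasureTheory UnitAddTorus
open Literature.Analysis Literature.Analysis.FunctionSpaces Literature.Analysis.FunctionSpaces.Torus
open Literature.Analysis.FunctionSpaces.EuclideanSpace
open Literature.Analysis.FluidPDE.ScalarFourier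
open Literature.Analysis.FluidPDE.SteadyLattice Literature.Analysis.FluidPDE.SteadyLatticeDrift

namespace Summit.AnomalousDissipation.AnomalousDissipation.Cruxes.NewtonRealisation.SketchLine

/-- The flat unit three-torus (local notation). -/
local notation "𝕋³" => UnitAddTorus (Fin 3)
/-- Velocity values (local notation). -/
local notation "E³" => EuclideanSpace ℝ (Fin 3)

/-- Square-summable families `ℤ³ → ℂ³` (local notation). -/
local notation "ℓ2" => lp (fun _ : Fin 3 → ℤ => EuclideanSpace ℂ (Fin 3)) 2
/-- The physical coefficients `x̌(k) = x(k)/|k|²` of a lattice family (local notation, = the frame's `cf`). -/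
local notation:max "cf[" x "]" =>
  ((fun mm : Fin 3 → ℤ => (((freqNormSq mm)⁻¹ : ℝ) : ℂ)) • (x : (Fin 3 → ℤ) → EuclideanSpace ℂ (Fin 3)))
/-- The coordinates of an element of `ℓ²` / of the state space (local notation). -/
local notation:max "cw[" x "]" => (((x : ℓ2)) : (Fin 3 → ℤ) → EuclideanSpace ℂ (Fin 3))
/-- The convective symbol `N(a, b)(k)` as a vector of `ℂ³` (local notation, = the frame's `nl`). -/
local notation:max "nl[" a "," b "]" k:max =>
  (WithLp.toLp 2 (fun pp : Fin 3 => transportSym (fun jj mm => (a : (Fin 3 → ℤ) → EuclideanSpace ℂ (Fin 3)) mm jj)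
    (fun mm => (b : (Fin 3 → ℤ) → EuclideanSpace ℂ (Fin 3)) mm pp) k) : EuclideanSpace ℂ (Fin 3))
/-- `k · v` for `k ∈ ℤ³`, `v ∈ ℂ³` (local notation, = the frame's `kdot`). -/
local notation:max "kdot[" k "," v "]" => (∑ jj : Fin 3, ((k jj : ℤ) : ℂ) * (v : EuclideanSpace ℂ (Fin 3)) jj)


/-! ## The stubs -/

/-- **stub A — ABSTRACT BORDERED FREDHOLM ALTERNATIVE (size M, Mathlib only).** On a real Banach space `E`, for `K`
compact, `c ≠ 0`, a vector `e` and a functional `φ`, if the bordered map `(x, t) ↦ (c•x + K x − t•e, φ x)` has trivial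
kernel then it is a linear homeomorphism of `E × ℝ`.  Why true: it is `c•1 + compact` on `E × ℝ` (`K ∘ fst`, and the
finite-rank pieces `t ↦ t•e`, `φ`, `t ↦ c t` are compact by `isCompactOperator_of_locallyCompactSpace_dom/rng`), so
`Literature.Analysis.Calculus.bijective_of_injective_of_isCompactOperator` (with `J = c • 1`) or
`SteadyLattice.exists_equiv_of_injective` on `E × ℝ` gives bijectivity, and `ContinuousLinearEquiv.ofBijective` the
homeomorphism. [folklore; Chow–Hale 1982 §2.4] -/
theorem stub_borderedFredholm :
    ∀ {E : Type} [NormedAddCommGroup E] [NormedSpace ℝ E] [CompleteSpace E]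
      (K : E →L[ℝ] E), IsCompactOperator K → ∀ (c : ℝ), c ≠ 0 → ∀ (e : E) (φ : E →L[ℝ] ℝ),
      (∀ (x : E) (t : ℝ), c • x + K x - t • e = 0 → φ x = 0 → x = 0 ∧ t = 0) →
      ∃ L : (E × ℝ) ≃L[ℝ] (E × ℝ), ∀ (x : E) (t : ℝ), L (x, t) = (c • x + K x - t • e, φ x) := by
  sorry

/-- **stub B — ABSTRACT QUANTITATIVE NEWTON STEP FOR THE QUADRATIC DRIFTED STEADY MAP (size M).** On a real Banach
space `E` with a bounded bilinear `B` (explicit bound `CB`), a bounded linear `D` (the drift direction), a functional `ℓ`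
(the border), a scalar `a` (`= 4π²ν`), a force `F`, a base point `(x₀, β₀)`: let
`Φ(x, β) := (a•x − β•D x + B x x − F, ℓ(x − x₀))` on `E × ℝ`; if `A = DΦ(x₀, β₀)`, i.e.
`A(h, η) = (a•h − β₀•D h − η•D x₀ + B x₀ h + B h x₀, ℓ h)`, is a linear homeomorphism with `‖A⁻¹‖ ≤ P` and the
Kantorovich premise `4·(2CB + 2‖D‖)·P·(P ρ) ≤ 1` holds, `ρ := ‖a•x₀ − β₀•D x₀ + B x₀ x₀ − F‖ = ‖Φ(x₀, β₀)‖`, then `Φ` has a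
zero `(x, β)` with `‖x − x₀‖, |β − β₀| ≤ 2Pρ`.  Why true: `Φ` is a continuous quadratic polynomial, `DΦ` is
`(2CB + 2‖D‖)`-Lipschitz in the sup norm of `E × ℝ`, and `Literature.Analysis.Calculus.exists_zero_near_of_simplifiedNewton`
(Magnus 2022 Prop. 6.7, proved in tree) applies with `M = 2CB + 2‖D‖`, `‖A⁻¹ Φ(x₀,β₀)‖ ≤ Pρ`. [cite: Magnus2022, Prop. 6.7] -/
theorem stub_quadraticNewton :
    ∀ {E : Type} [NormedAddCommGroup E] [NormedSpace ℝ E] [CompleteSpace E]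
      (B : E → E → E) (CB : ℝ), IsBoundedBilinearMap ℝ (fun p : E × E => B p.1 p.2) →
      0 ≤ CB → (∀ x y : E, ‖B x y‖ ≤ CB * ‖x‖ * ‖y‖) →
      ∀ (D : E →L[ℝ] E) (ℓ : E →L[ℝ] ℝ) (a : ℝ) (F x₀ : E) (β₀ P : ℝ)
        (A : (E × ℝ) ≃L[ℝ] (E × ℝ)),
      (∀ (h : E) (η : ℝ), A (h, η) = (a • h - β₀ • D h - η • D x₀ + B x₀ h + B h x₀, ℓ h)) →
      ‖(A.symm : (E × ℝ) →L[ℝ] (E × ℝ))‖ ≤ P →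
      4 * (2 * CB + 2 * ‖D‖) * P * (P * ‖a • x₀ - β₀ • D x₀ + B x₀ x₀ - F‖) ≤ 1 →
      ∃ (x : E) (β : ℝ), a • x - β • D x + B x x = F ∧ ℓ (x - x₀) = 0 ∧
        ‖x - x₀‖ ≤ 2 * P * ‖a • x₀ - β₀ • D x₀ + B x₀ x₀ - F‖ ∧
        |β - β₀| ≤ 2 * P * ‖a • x₀ - β₀ • D x₀ + B x₀ x₀ - F‖ := by
  sorry

/-- **stub D — ELEMENTARY TORUS CALCULUS (size S).** (i) For smooth divergence-free `w` and smooth `q` the full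
left-hand side `w·∇w − νΔw + ∇q − c∂₃w` is smooth and MEAN-ZERO (`∫ w·∇w = 0` by `div w = 0` and integration by parts,
`∫ Δw = ∫ ∇q = ∫ ∂₃w = 0`); (ii) Minkowski for the gradient seminorm `√gradNormSq v ≤ √gradNormSq u + √gradNormSq (u − v)`
and the energy splitting `∫‖u‖² ≤ 2∫‖v‖² + 2∫‖u − v‖²` for smooth fields.  Leans on the torus calculus API
(`IsSmooth.convect/laplacian/gradient/partialDeriv/sub`, `integral_convect_eq_zero`-type identities,
`gradNormSq` as `Σᵢ∫‖∂ᵢ·‖²`). [folklore] -/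
theorem stub_calculusFacts :
    (∀ (ν : ℝ) (w : 𝕋³ → E³) (q : 𝕋³ → ℝ) (c : ℝ), IsSmooth w → IsDivFree w → IsSmooth q →
      IsSmooth (fun x => Torus.convect w w x - ν • Torus.laplacian w x + Torus.gradient q x -
          c • Torus.partialDeriv (2 : Fin 3) w x) ∧
        HasZeroMean (fun x => Torus.convect w w x - ν • Torus.laplacian w x + Torus.gradient q x -
          c • Torus.partialDeriv (2 : Fin 3) w x)) ∧
    (∀ (u v : 𝕋³ → E³), IsSmooth u → IsSmooth v →
      Real.sqrt (gradNormSq v) ≤ Real.sqrt (gradNormSq u) + Real.sqrt (gradNormSq (fun x => u x - v x)) ∧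
      MeasureTheory.integral MeasureTheory.volume (fun x => ‖u x‖ ^ 2) ≤
        2 * MeasureTheory.integral MeasureTheory.volume (fun x => ‖v x‖ ^ 2) +
          2 * MeasureTheory.integral MeasureTheory.volume (fun x => ‖u x - v x‖ ^ 2)) := by
  sorry

/-- **stub E — DRIFT ABSORPTION (size M; VERBATIM the registered stub 3 of `Lines/birth.lean`).** A smooth drifting
steady state `W·∇W − νΔW + ∇Q − c'∂₃W = f` (`W` smooth, divergence free, mean zero) gives the time-constant classical
solution `u = W − c'e₃` of `NS_ν(f)` on `T³ × ℝ` (`(W − c'e₃)·∇(W − c'e₃) = W·∇W − c'∂₃W`, `∂ₜu = 0`), with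
`‖∇u‖₂² = ‖∇W‖₂²` and `∫‖u‖² = ∫‖W‖² + c'²`.  Leans on `Literature.Analysis.FluidPDE.isSmoothSpaceTimeOn_const`,
`Torus.timeDerivWithin`, `Torus.convect` linearity in the transporting vector, `partialDeriv` of a constant,
`IsSmooth.integrable`, `integral_inner`, `EuclideanSpace.norm_single`. [folklore; Galdi2011] -/
theorem stub_driftAbsorption :
    ∀ (ν : ℝ) (f W : 𝕋³ → E³) (Q : 𝕋³ → ℝ) (c' : ℝ), IsSmooth W → IsSmooth Q → IsDivFree W →
      HasZeroMean W →
      (∀ x, Torus.convect W W x - ν • Torus.laplacian W x + Torus.gradient Q x -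
          c' • Torus.partialDeriv (2 : Fin 3) W x = f x) →
      IsClassicalNSSolutionOn Set.univ ν (fun _ => f)
          (fun _ x => W x - c' • EuclideanSpace.single (2 : Fin 3) (1 : ℝ)) (fun _ => Q) ∧
        gradNormSq (fun x => W x - c' • EuclideanSpace.single (2 : Fin 3) (1 : ℝ)) = gradNormSq W ∧
        MeasureTheory.integral MeasureTheory.volume
            (fun x => ‖W x - c' • EuclideanSpace.single (2 : Fin 3) (1 : ℝ)‖ ^ 2) =
          MeasureTheory.integral MeasureTheory.volume (fun x => ‖W x‖ ^ 2) + c' ^ 2 := by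
  sorry

/-! ## The three lattice stubs (statements) -/

/-- **stub L1 — LATTICE DICTIONARY (size M+; three conjuncts, each an assembly of tree theorems).** In the frame of
`Literature.Analysis.FluidPDE.SteadyLattice` / `SteadyLatticeDrift` (state space `W ⊂ ℓ²(ℤ³;ℂ³)` characterised by `hW`,
bilinear map `B` characterised by `hB`, drift multiplier `D₃` along `e₃` characterised by `hD₃`; an element `x : W`
represents the physical coefficients `x̌(k) = x(k)/|k|²`):
(D1) BASE STATE — a classical steady state `u₀ − c e₃` of `NS_ν(f₀)` (`u₀` smooth, divergence free, mean zero; this is the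
drifted equation `u₀·∇u₀ − νΔu₀ + ∇p₀ − c∂₃u₀ = f₀`) gives `x₀ ∈ W` with `x̌₀ = 𝓕u₀` solving the drifted lattice equation
`(4π²ν)x₀ − c D₃x₀ + B(x₀,x₀) = Π 𝓕f₀` coordinatewise (`SteadyLatticeDrift.fourier_eq_drift_of_isSteadyNSState` with zero
mode `𝓕(u₀ − ce₃)(0) = complexify(−c e₃)`, `k·(−c e₃) = −c k₃`; membership in `W` as in §3 of
`steadyPersistsInLeaf_of_nondeg`; `smul_eq_weight_smul_cf`, `cf_weight_smul'`);
(D2) SYNTHESIS — conversely a solution `(x, β) ∈ W × ℝ` of `(4π²ν)x − β D₃x + B(x,x) = Π 𝓕f` (`f` smooth, divergence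
free, mean zero) has rapidly decaying `x̌` (`SteadyLatticeDrift.rapidDecay_of_perturbed_eq` with `a = δ₀(complexify(−βe₃))`,
`leray_nl_linearised_single`) and synthesises (`steadyState_of_fourier_drift`, then add back the mean `βe₃`) a smooth
divergence-free MEAN-ZERO `u` and a smooth `p` with `u·∇u − νΔu + ∇p − β∂₃u = f` and `𝓕u = x̌`;
(D3) FORCES — smooth mean-zero `g₁, g₂` give `G₁, G₂ ∈ W` with coordinates `Π 𝓕gᵢ(k)` and
`‖G₁ − G₂‖² ≤ ∫‖g₁ − g₂‖²` (Parseval `integral_norm_sq_eq_tsum` + `norm_lerayCoeff_le`; membership: `ĝ(0) = 0`,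
`kdot_lerayCoeff`, `lerayCoeff_neg_conjVec`, `isConjSymm_mFourierCoeff`, `memℓp_two_of_tsum_ne_top`). [folklore; Temam1979 Ch. II §1] -/
theorem stub_latticeDictionary :
    ∀ {W : Submodule ℝ ℓ2}
      (hW : ∀ x : ℓ2, x ∈ W ↔ cw[x] 0 = 0 ∧ (∀ kk : Fin 3 → ℤ, kdot[kk, cw[x] kk] = 0) ∧ IsConjSymm cw[x])
      {B : W → W → W} (hB : ∀ x y : W, cw[B x y] = fun k => FluidPDE.Torus.lerayCoeff k (nl[cf[cw[x]], cf[cw[y]]] k))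
      {D₃ : W →L[ℝ] W}
      (hD₃ : ∀ x : W, cw[D₃ x] = fun k => (2 * Real.pi * Complex.I * ((k (2 : Fin 3) : ℤ) : ℂ)) • cf[cw[x]] k),
    (∀ (ν : ℝ) (f₀ u₀ : 𝕋³ → E³) (p₀ : 𝕋³ → ℝ) (c : ℝ), 0 < ν → IsSmooth f₀ → HasZeroMean f₀ →
      IsSmooth u₀ → IsDivFree u₀ → HasZeroMean u₀ →
      FluidPDE.Torus.IsSteadyNSState ν f₀ (fun x => u₀ x - c • EuclideanSpace.single (2 : Fin 3) (1 : ℝ)) p₀ →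
      ∃ x₀ : W, cf[cw[x₀]] = mFourierCoeff (complexify ∘ u₀) ∧
        ∀ k : Fin 3 → ℤ, cw[((4 * Real.pi ^ 2 * ν) • x₀ - c • D₃ x₀ + B x₀ x₀ : W)] k =
          FluidPDE.Torus.lerayCoeff k (mFourierCoeff (complexify ∘ f₀) k)) ∧
    (∀ (ν : ℝ) (f : 𝕋³ → E³) (x : W) (β : ℝ), 0 < ν → IsSmooth f → IsDivFree f → HasZeroMean f →
      (∀ k : Fin 3 → ℤ, cw[((4 * Real.pi ^ 2 * ν) • x - β • D₃ x + B x x : W)] k =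
          FluidPDE.Torus.lerayCoeff k (mFourierCoeff (complexify ∘ f) k)) →
      ∃ (u : 𝕋³ → E³) (p : 𝕋³ → ℝ), IsSmooth u ∧ IsSmooth p ∧ IsDivFree u ∧ HasZeroMean u ∧
        (∀ y, Torus.convect u u y - ν • Torus.laplacian u y + Torus.gradient p y -
            β • Torus.partialDeriv (2 : Fin 3) u y = f y) ∧
        mFourierCoeff (complexify ∘ u) = cf[cw[x]]) ∧
    (∀ (g₁ g₂ : 𝕋³ → E³), IsSmooth g₁ → HasZeroMean g₁ → IsSmooth g₂ → HasZeroMean g₂ →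
      ∃ G₁ G₂ : W, (∀ k : Fin 3 → ℤ, cw[G₁] k = FluidPDE.Torus.lerayCoeff k (mFourierCoeff (complexify ∘ g₁) k)) ∧
        (∀ k : Fin 3 → ℤ, cw[G₂] k = FluidPDE.Torus.lerayCoeff k (mFourierCoeff (complexify ∘ g₂) k)) ∧
        ‖G₁ - G₂‖ ^ 2 ≤ MeasureTheory.integral MeasureTheory.volume (fun y => ‖g₁ y - g₂ y‖ ^ 2)) := by
  sorry

/-- **stub L2 — A-PRIORI TRANSFER (size L; the heart, held by the lead).** The crux's bordered `L²` a-priori bound at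
the state `(u₀, c)` with constant `M` transfers to the lattice: for every `h ∈ W` with rapidly decaying `ȟ` and every
real `η`, `‖ȟ‖²_{ℓ²} + η² ≤ M² (‖(4π²ν)h − cD₃h + B(x₀,h) + B(h,x₀) − ηD₃x₀‖²_W + (ℓ h)²)`, where `ℓ h = Re Σₖ ⟪ȟ(k),
(D₃x₀)(k)⟫ = ∫⟪v, ∂₃u₀⟫`.  Proof: `v := Re F_{ȟ}` is smooth, real, divergence free, mean zero (`realSynth_spec`,
`cf_transversal`, `W_zero`); the physical field `Ψ := u₀·∇v + v·∇u₀ − νΔv − c∂₃v − η∂₃u₀` is smooth and mean zero, and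
with the smooth pressure `r` of symbol `−(k·Ψ̂(k))/(2πi|k|²)` (`rapidDecay_pressureSymbol`, `fourierSynth`) the field
`Ψ + ∇r` has coefficients `Π_k Ψ̂(k)` (as in `steadyState_of_fourier'`); the dictionary (`mFourierCoeff_convect_real`,
`mFourierCoeff_partialDeriv`, Laplacian symbol `−4π²|k|²`, `lerayCoeff_of_kdot_eq_zero`) identifies `Π_k Ψ̂(k)` with the
`k`-th coordinate of `(4π²ν)h − cD₃h + B(x₀,h) + B(h,x₀) − ηD₃x₀`; the a-priori bound at `(v, r, η)` and Parseval
(`integral_norm_sq_eq_tsum`, `l2_norm_sq_eq_tsum`, `hasSum_re_inner_mFourierCoeff_complexify`) give the claim. [folklore] -/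
theorem stub_aprioriTransfer :
    ∀ {W : Submodule ℝ ℓ2}
      (hW : ∀ x : ℓ2, x ∈ W ↔ cw[x] 0 = 0 ∧ (∀ kk : Fin 3 → ℤ, kdot[kk, cw[x] kk] = 0) ∧ IsConjSymm cw[x])
      {B : W → W → W} (hB : ∀ x y : W, cw[B x y] = fun k => FluidPDE.Torus.lerayCoeff k (nl[cf[cw[x]], cf[cw[y]]] k))
      {D₃ : W →L[ℝ] W}
      (hD₃ : ∀ x : W, cw[D₃ x] = fun k => (2 * Real.pi * Complex.I * ((k (2 : Fin 3) : ℤ) : ℂ)) • cf[cw[x]] k)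
      (ν c M : ℝ) (u₀ : 𝕋³ → E³) (x₀ : W) (ℓ : W →L[ℝ] ℝ),
      0 < ν → IsSmooth u₀ → IsDivFree u₀ → HasZeroMean u₀ →
      cf[cw[x₀]] = mFourierCoeff (complexify ∘ u₀) →
      (∀ h : W, ℓ h = ∑' k : Fin 3 → ℤ, (inner ℂ (cf[cw[h]] k) (cw[D₃ x₀] k)).re) →
      (∀ (v : 𝕋³ → E³) (r : 𝕋³ → ℝ) (b : ℝ), IsSmooth v → IsSmooth r → IsDivFree v → HasZeroMean v →
        MeasureTheory.integral MeasureTheory.volume (fun x => ‖v x‖ ^ 2) + b ^ 2 ≤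
          M ^ 2 * (MeasureTheory.integral MeasureTheory.volume (fun x =>
            ‖Torus.convect u₀ v x + Torus.convect v u₀ x - ν • Torus.laplacian v x + Torus.gradient r x -
              c • Torus.partialDeriv (2 : Fin 3) v x - b • Torus.partialDeriv (2 : Fin 3) u₀ x‖ ^ 2) +
            (MeasureTheory.integral MeasureTheory.volume (fun x =>
              inner ℝ (v x) (Torus.partialDeriv (2 : Fin 3) u₀ x))) ^ 2)) →
      ∀ (h : W) (η : ℝ), RapidDecay cf[cw[h]] →
        (∑' k : Fin 3 → ℤ, ‖cf[cw[h]] k‖ ^ 2) + η ^ 2 ≤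
          M ^ 2 * (‖(4 * Real.pi ^ 2 * ν) • h - c • D₃ h + B x₀ h + B h x₀ - η • D₃ x₀‖ ^ 2 + (ℓ h) ^ 2) := by
  sorry

/-- **stub L3 — ELLIPTIC STEP + DENSITY (size L−).** From the lattice `ℓ²` a-priori bound of stub L2 (taken as a
hypothesis, valid for `h` with rapidly decaying `ȟ`) to the `W`-norm inverse bound with POLYNOMIAL loss, for ALL
`(h, η) ∈ W × ℝ`: `‖h‖ + |η| ≤ A(1+M)^k(1+C)^kν^{-k} (‖(4π²ν)h − cD₃h + B(x₀,h) + B(h,x₀) − ηD₃x₀‖ + |ℓ h|)` with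
universal `k, A`.  Proof: (i) for rapidly decaying `ȟ` rearrange `(4π²ν)h = T + cD₃h − B(x₀,h) − B(h,x₀) + ηD₃x₀` and
bound `‖D₃h‖ ≤ 2π(‖ȟ‖‖h‖)^{1/2}` (lattice Cauchy–Schwarz, `|k|²‖ȟ(k)‖ = ‖h(k)‖`), `‖B(x₀,h) + B(h,x₀)‖ ≤
‖u₀·∇v + v·∇u₀‖₂ ≤ C√(gradNormSq v) + √3 Cν⁻¹‖v‖₂` (Parseval + `norm_lerayCoeff_le` + the sup bounds; `v` the
synthesis of `ȟ`), `gradNormSq v = 4π²Σ|k|²‖ȟ(k)‖² ≤ 4π²‖ȟ‖‖h‖`, `‖D₃x₀‖ ≤ ‖∂₃u₀‖₂ ≤ Cν⁻¹`, then absorb by AM–GM using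
`‖ȟ‖, |η| ≤ M(‖T‖ + |ℓ h|)`: loss `(1+C)²(1+M)ν⁻²`; (ii) density: truncations `𝟙_{|k|∞≤N} h ∈ W` (symmetric ball:
zero mode, transversality, conjugate symmetry preserved; `Lattice.trunc`, `rapidDecay_trunc`) converge to `h` in `W`
(tail of `Σ‖h(k)‖²`), both sides are continuous in `h` (`hBb`, `D₃`, `ℓ` continuous), so the bound passes to all `h`.
[folklore] -/
theorem stub_ellipticDensity :
    ∃ (k : ℕ) (A : ℝ), 0 < A ∧ ∀ {W : Submodule ℝ ℓ2}
      (hW : ∀ x : ℓ2, x ∈ W ↔ cw[x] 0 = 0 ∧ (∀ kk : Fin 3 → ℤ, kdot[kk, cw[x] kk] = 0) ∧ IsConjSymm cw[x])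
      {B : W → W → W} (hB : ∀ x y : W, cw[B x y] = fun k => FluidPDE.Torus.lerayCoeff k (nl[cf[cw[x]], cf[cw[y]]] k))
      (hBb : IsBoundedBilinearMap ℝ (fun p : W × W => B p.1 p.2))
      {D₃ : W →L[ℝ] W}
      (hD₃ : ∀ x : W, cw[D₃ x] = fun k => (2 * Real.pi * Complex.I * ((k (2 : Fin 3) : ℤ) : ℂ)) • cf[cw[x]] k)
      (ν c M C : ℝ) (u₀ : 𝕋³ → E³) (x₀ : W) (ℓ : W →L[ℝ] ℝ),
      0 < ν → ν ≤ 1 → 0 ≤ M → 0 ≤ C → IsSmooth u₀ → IsDivFree u₀ → HasZeroMean u₀ → |c| ≤ C →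
      (∀ x, ‖u₀ x‖ ≤ C) → (∀ (i : Fin 3) x, ‖Torus.partialDeriv i u₀ x‖ ≤ C * ν⁻¹) →
      cf[cw[x₀]] = mFourierCoeff (complexify ∘ u₀) →
      (∀ (h : W) (η : ℝ), RapidDecay cf[cw[h]] →
        (∑' k : Fin 3 → ℤ, ‖cf[cw[h]] k‖ ^ 2) + η ^ 2 ≤
          M ^ 2 * (‖(4 * Real.pi ^ 2 * ν) • h - c • D₃ h + B x₀ h + B h x₀ - η • D₃ x₀‖ ^ 2 + (ℓ h) ^ 2)) →
      ∀ (h : W) (η : ℝ), ‖h‖ + |η| ≤ A * (1 + M) ^ k * (1 + C) ^ k * ν⁻¹ ^ k *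
        (‖(4 * Real.pi ^ 2 * ν) • h - c • D₃ h + B x₀ h + B h x₀ - η • D₃ x₀‖ + |ℓ h|) := by
  sorry


/-! ## Name-keyed aliases of the stub statements — the hypotheses of `NewtonRealisation_of`

(`__Registered.stub_X` is the statement of `stub_X` verbatim under the stub's short name; device of
`Cruxes/NewtonRealisation/Lines/birth.lean`.) -/
namespace __Registered

/-- Alias of the statement of `stub_borderedFredholm`, keyed by the stub name. -/
abbrev stub_borderedFredholm : Prop :=
    ∀ {E : Type} [NormedAddCommGroup E] [NormedSpace ℝ E] [CompleteSpace E]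
      (K : E →L[ℝ] E), IsCompactOperator K → ∀ (c : ℝ), c ≠ 0 → ∀ (e : E) (φ : E →L[ℝ] ℝ),
      (∀ (x : E) (t : ℝ), c • x + K x - t • e = 0 → φ x = 0 → x = 0 ∧ t = 0) →
      ∃ L : (E × ℝ) ≃L[ℝ] (E × ℝ), ∀ (x : E) (t : ℝ), L (x, t) = (c • x + K x - t • e, φ x)

/-- Alias of the statement of `stub_quadraticNewton`, keyed by the stub name. -/
abbrev stub_quadraticNewton : Prop :=
    ∀ {E : Type} [NormedAddCommGroup E] [NormedSpace ℝ E] [CompleteSpace E]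
      (B : E → E → E) (CB : ℝ), IsBoundedBilinearMap ℝ (fun p : E × E => B p.1 p.2) →
      0 ≤ CB → (∀ x y : E, ‖B x y‖ ≤ CB * ‖x‖ * ‖y‖) →
      ∀ (D : E →L[ℝ] E) (ℓ : E →L[ℝ] ℝ) (a : ℝ) (F x₀ : E) (β₀ P : ℝ)
        (A : (E × ℝ) ≃L[ℝ] (E × ℝ)),
      (∀ (h : E) (η : ℝ), A (h, η) = (a • h - β₀ • D h - η • D x₀ + B x₀ h + B h x₀, ℓ h)) →
      ‖(A.symm : (E × ℝ) →L[ℝ] (E × ℝ))‖ ≤ P →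
      4 * (2 * CB + 2 * ‖D‖) * P * (P * ‖a • x₀ - β₀ • D x₀ + B x₀ x₀ - F‖) ≤ 1 →
      ∃ (x : E) (β : ℝ), a • x - β • D x + B x x = F ∧ ℓ (x - x₀) = 0 ∧
        ‖x - x₀‖ ≤ 2 * P * ‖a • x₀ - β₀ • D x₀ + B x₀ x₀ - F‖ ∧
        |β - β₀| ≤ 2 * P * ‖a • x₀ - β₀ • D x₀ + B x₀ x₀ - F‖

/-- Alias of the statement of `stub_latticeDictionary`, keyed by the stub name. -/
abbrev stub_latticeDictionary : Prop :=
    ∀ {W : Submodule ℝ ℓ2}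
      (hW : ∀ x : ℓ2, x ∈ W ↔ cw[x] 0 = 0 ∧ (∀ kk : Fin 3 → ℤ, kdot[kk, cw[x] kk] = 0) ∧ IsConjSymm cw[x])
      {B : W → W → W} (hB : ∀ x y : W, cw[B x y] = fun k => FluidPDE.Torus.lerayCoeff k (nl[cf[cw[x]], cf[cw[y]]] k))
      {D₃ : W →L[ℝ] W}
      (hD₃ : ∀ x : W, cw[D₃ x] = fun k => (2 * Real.pi * Complex.I * ((k (2 : Fin 3) : ℤ) : ℂ)) • cf[cw[x]] k),
    (∀ (ν : ℝ) (f₀ u₀ : 𝕋³ → E³) (p₀ : 𝕋³ → ℝ) (c : ℝ), 0 < ν → IsSmooth f₀ → HasZeroMean f₀ →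
      IsSmooth u₀ → IsDivFree u₀ → HasZeroMean u₀ →
      FluidPDE.Torus.IsSteadyNSState ν f₀ (fun x => u₀ x - c • EuclideanSpace.single (2 : Fin 3) (1 : ℝ)) p₀ →
      ∃ x₀ : W, cf[cw[x₀]] = mFourierCoeff (complexify ∘ u₀) ∧
        ∀ k : Fin 3 → ℤ, cw[((4 * Real.pi ^ 2 * ν) • x₀ - c • D₃ x₀ + B x₀ x₀ : W)] k =
          FluidPDE.Torus.lerayCoeff k (mFourierCoeff (complexify ∘ f₀) k)) ∧
    (∀ (ν : ℝ) (f : 𝕋³ → E³) (x : W) (β : ℝ), 0 < ν → IsSmooth f → IsDivFree f → HasZeroMean f →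
      (∀ k : Fin 3 → ℤ, cw[((4 * Real.pi ^ 2 * ν) • x - β • D₃ x + B x x : W)] k =
          FluidPDE.Torus.lerayCoeff k (mFourierCoeff (complexify ∘ f) k)) →
      ∃ (u : 𝕋³ → E³) (p : 𝕋³ → ℝ), IsSmooth u ∧ IsSmooth p ∧ IsDivFree u ∧ HasZeroMean u ∧
        (∀ y, Torus.convect u u y - ν • Torus.laplacian u y + Torus.gradient p y -
            β • Torus.partialDeriv (2 : Fin 3) u y = f y) ∧
        mFourierCoeff (complexify ∘ u) = cf[cw[x]]) ∧
    (∀ (g₁ g₂ : 𝕋³ → E³), IsSmooth g₁ → HasZeroMean g₁ → IsSmooth g₂ → HasZeroMean g₂ →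
      ∃ G₁ G₂ : W, (∀ k : Fin 3 → ℤ, cw[G₁] k = FluidPDE.Torus.lerayCoeff k (mFourierCoeff (complexify ∘ g₁) k)) ∧
        (∀ k : Fin 3 → ℤ, cw[G₂] k = FluidPDE.Torus.lerayCoeff k (mFourierCoeff (complexify ∘ g₂) k)) ∧
        ‖G₁ - G₂‖ ^ 2 ≤ MeasureTheory.integral MeasureTheory.volume (fun y => ‖g₁ y - g₂ y‖ ^ 2))

/-- Alias of the statement of `stub_aprioriTransfer`, keyed by the stub name. -/
abbrev stub_aprioriTransfer : Prop :=
    ∀ {W : Submodule ℝ ℓ2}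
      (hW : ∀ x : ℓ2, x ∈ W ↔ cw[x] 0 = 0 ∧ (∀ kk : Fin 3 → ℤ, kdot[kk, cw[x] kk] = 0) ∧ IsConjSymm cw[x])
      {B : W → W → W} (hB : ∀ x y : W, cw[B x y] = fun k => FluidPDE.Torus.lerayCoeff k (nl[cf[cw[x]], cf[cw[y]]] k))
      {D₃ : W →L[ℝ] W}
      (hD₃ : ∀ x : W, cw[D₃ x] = fun k => (2 * Real.pi * Complex.I * ((k (2 : Fin 3) : ℤ) : ℂ)) • cf[cw[x]] k)
      (ν c M : ℝ) (u₀ : 𝕋³ → E³) (x₀ : W) (ℓ : W →L[ℝ] ℝ),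
      0 < ν → IsSmooth u₀ → IsDivFree u₀ → HasZeroMean u₀ →
      cf[cw[x₀]] = mFourierCoeff (complexify ∘ u₀) →
      (∀ h : W, ℓ h = ∑' k : Fin 3 → ℤ, (inner ℂ (cf[cw[h]] k) (cw[D₃ x₀] k)).re) →
      (∀ (v : 𝕋³ → E³) (r : 𝕋³ → ℝ) (b : ℝ), IsSmooth v → IsSmooth r → IsDivFree v → HasZeroMean v →
        MeasureTheory.integral MeasureTheory.volume (fun x => ‖v x‖ ^ 2) + b ^ 2 ≤
          M ^ 2 * (MeasureTheory.integral MeasureTheory.volume (fun x =>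
            ‖Torus.convect u₀ v x + Torus.convect v u₀ x - ν • Torus.laplacian v x + Torus.gradient r x -
              c • Torus.partialDeriv (2 : Fin 3) v x - b • Torus.partialDeriv (2 : Fin 3) u₀ x‖ ^ 2) +
            (MeasureTheory.integral MeasureTheory.volume (fun x =>
              inner ℝ (v x) (Torus.partialDeriv (2 : Fin 3) u₀ x))) ^ 2)) →
      ∀ (h : W) (η : ℝ), RapidDecay cf[cw[h]] →
        (∑' k : Fin 3 → ℤ, ‖cf[cw[h]] k‖ ^ 2) + η ^ 2 ≤
          M ^ 2 * (‖(4 * Real.pi ^ 2 * ν) • h - c • D₃ h + B x₀ h + B h x₀ - η • D₃ x₀‖ ^ 2 + (ℓ h) ^ 2)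

/-- Alias of the statement of `stub_ellipticDensity`, keyed by the stub name. -/
abbrev stub_ellipticDensity : Prop :=
    ∃ (k : ℕ) (A : ℝ), 0 < A ∧ ∀ {W : Submodule ℝ ℓ2}
      (hW : ∀ x : ℓ2, x ∈ W ↔ cw[x] 0 = 0 ∧ (∀ kk : Fin 3 → ℤ, kdot[kk, cw[x] kk] = 0) ∧ IsConjSymm cw[x])
      {B : W → W → W} (hB : ∀ x y : W, cw[B x y] = fun k => FluidPDE.Torus.lerayCoeff k (nl[cf[cw[x]], cf[cw[y]]] k))
      (hBb : IsBoundedBilinearMap ℝ (fun p : W × W => B p.1 p.2))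
      {D₃ : W →L[ℝ] W}
      (hD₃ : ∀ x : W, cw[D₃ x] = fun k => (2 * Real.pi * Complex.I * ((k (2 : Fin 3) : ℤ) : ℂ)) • cf[cw[x]] k)
      (ν c M C : ℝ) (u₀ : 𝕋³ → E³) (x₀ : W) (ℓ : W →L[ℝ] ℝ),
      0 < ν → ν ≤ 1 → 0 ≤ M → 0 ≤ C → IsSmooth u₀ → IsDivFree u₀ → HasZeroMean u₀ → |c| ≤ C →
      (∀ x, ‖u₀ x‖ ≤ C) → (∀ (i : Fin 3) x, ‖Torus.partialDeriv i u₀ x‖ ≤ C * ν⁻¹) →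
      cf[cw[x₀]] = mFourierCoeff (complexify ∘ u₀) →
      (∀ (h : W) (η : ℝ), RapidDecay cf[cw[h]] →
        (∑' k : Fin 3 → ℤ, ‖cf[cw[h]] k‖ ^ 2) + η ^ 2 ≤
          M ^ 2 * (‖(4 * Real.pi ^ 2 * ν) • h - c • D₃ h + B x₀ h + B h x₀ - η • D₃ x₀‖ ^ 2 + (ℓ h) ^ 2)) →
      ∀ (h : W) (η : ℝ), ‖h‖ + |η| ≤ A * (1 + M) ^ k * (1 + C) ^ k * ν⁻¹ ^ k *
        (‖(4 * Real.pi ^ 2 * ν) • h - c • D₃ h + B x₀ h + B h x₀ - η • D₃ x₀‖ + |ℓ h|)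

/-- Alias of the statement of `stub_calculusFacts`, keyed by the stub name. -/
abbrev stub_calculusFacts : Prop :=
    (∀ (ν : ℝ) (w : 𝕋³ → E³) (q : 𝕋³ → ℝ) (c : ℝ), IsSmooth w → IsDivFree w → IsSmooth q →
      IsSmooth (fun x => Torus.convect w w x - ν • Torus.laplacian w x + Torus.gradient q x -
          c • Torus.partialDeriv (2 : Fin 3) w x) ∧
        HasZeroMean (fun x => Torus.convect w w x - ν • Torus.laplacian w x + Torus.gradient q x -
          c • Torus.partialDeriv (2 : Fin 3) w x)) ∧
    (∀ (u v : 𝕋³ → E³), IsSmooth u → IsSmooth v →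
      Real.sqrt (gradNormSq v) ≤ Real.sqrt (gradNormSq u) + Real.sqrt (gradNormSq (fun x => u x - v x)) ∧
      MeasureTheory.integral MeasureTheory.volume (fun x => ‖u x‖ ^ 2) ≤
        2 * MeasureTheory.integral MeasureTheory.volume (fun x => ‖v x‖ ^ 2) +
          2 * MeasureTheory.integral MeasureTheory.volume (fun x => ‖u x - v x‖ ^ 2))

/-- Alias of the statement of `stub_driftAbsorption`, keyed by the stub name. -/
abbrev stub_driftAbsorption : Prop :=
    ∀ (ν : ℝ) (f W : 𝕋³ → E³) (Q : 𝕋³ → ℝ) (c' : ℝ), IsSmooth W → IsSmooth Q → IsDivFree W →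
      HasZeroMean W →
      (∀ x, Torus.convect W W x - ν • Torus.laplacian W x + Torus.gradient Q x -
          c' • Torus.partialDeriv (2 : Fin 3) W x = f x) →
      IsClassicalNSSolutionOn Set.univ ν (fun _ => f)
          (fun _ x => W x - c' • EuclideanSpace.single (2 : Fin 3) (1 : ℝ)) (fun _ => Q) ∧
        gradNormSq (fun x => W x - c' • EuclideanSpace.single (2 : Fin 3) (1 : ℝ)) = gradNormSq W ∧
        MeasureTheory.integral MeasureTheory.volume
            (fun x => ‖W x - c' • EuclideanSpace.single (2 : Fin 3) (1 : ℝ)‖ ^ 2) =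
          MeasureTheory.integral MeasureTheory.volume (fun x => ‖W x‖ ^ 2) + c' ^ 2

end __Registered

/-! ## The composition: `C⁺` from the three lattice stubs and the two abstract stubs -/

set_option maxHeartbeats 3200000 in
/-- **`C⁺` from the lattice stubs** (the quantitative bordered twin of
`SteadyLatticeDrift.steadyPersistsInLeaf_of_nondeg`). -/
theorem quantPersistenceCore_of_lattice
    (hL1 : type_of% @stub_latticeDictionary) (hL2 : type_of% @stub_aprioriTransfer)
    (hL3 : type_of% @stub_ellipticDensity)
    (hDA : ∀ (ν : ℝ) (f W : 𝕋³ → E³) (Q : 𝕋³ → ℝ) (c' : ℝ), IsSmooth W → IsSmooth Q → IsDivFree W →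
      HasZeroMean W →
      (∀ x, Torus.convect W W x - ν • Torus.laplacian W x + Torus.gradient Q x -
          c' • Torus.partialDeriv (2 : Fin 3) W x = f x) →
      IsClassicalNSSolutionOn Set.univ ν (fun _ => f)
          (fun _ x => W x - c' • EuclideanSpace.single (2 : Fin 3) (1 : ℝ)) (fun _ => Q) ∧
        gradNormSq (fun x => W x - c' • EuclideanSpace.single (2 : Fin 3) (1 : ℝ)) = gradNormSq W ∧
        MeasureTheory.integral MeasureTheory.volume
            (fun x => ‖W x - c' • EuclideanSpace.single (2 : Fin 3) (1 : ℝ)‖ ^ 2) =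
          MeasureTheory.integral MeasureTheory.volume (fun x => ‖W x‖ ^ 2) + c' ^ 2) :
    (∀ {E : Type} [NormedAddCommGroup E] [NormedSpace ℝ E] [CompleteSpace E]
      (K : E →L[ℝ] E), IsCompactOperator K → ∀ (c : ℝ), c ≠ 0 → ∀ (e : E) (φ : E →L[ℝ] ℝ),
      (∀ (x : E) (t : ℝ), c • x + K x - t • e = 0 → φ x = 0 → x = 0 ∧ t = 0) →
      ∃ L : (E × ℝ) ≃L[ℝ] (E × ℝ), ∀ (x : E) (t : ℝ), L (x, t) = (c • x + K x - t • e, φ x)) →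
    (∀ {E : Type} [NormedAddCommGroup E] [NormedSpace ℝ E] [CompleteSpace E]
      (B : E → E → E) (CB : ℝ), IsBoundedBilinearMap ℝ (fun p : E × E => B p.1 p.2) →
      0 ≤ CB → (∀ x y : E, ‖B x y‖ ≤ CB * ‖x‖ * ‖y‖) →
      ∀ (D : E →L[ℝ] E) (ℓ : E →L[ℝ] ℝ) (a : ℝ) (F x₀ : E) (β₀ P : ℝ)
        (A : (E × ℝ) ≃L[ℝ] (E × ℝ)),
      (∀ (h : E) (η : ℝ), A (h, η) = (a • h - β₀ • D h - η • D x₀ + B x₀ h + B h x₀, ℓ h)) →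
      ‖(A.symm : (E × ℝ) →L[ℝ] (E × ℝ))‖ ≤ P →
      4 * (2 * CB + 2 * ‖D‖) * P * (P * ‖a • x₀ - β₀ • D x₀ + B x₀ x₀ - F‖) ≤ 1 →
      ∃ (x : E) (β : ℝ), a • x - β • D x + B x x = F ∧ ℓ (x - x₀) = 0 ∧
        ‖x - x₀‖ ≤ 2 * P * ‖a • x₀ - β₀ • D x₀ + B x₀ x₀ - F‖ ∧
        |β - β₀| ≤ 2 * P * ‖a • x₀ - β₀ • D x₀ + B x₀ x₀ - F‖) →
    ∃ (k : ℕ) (A : ℝ), 0 < A ∧ ∀ (ν C M : ℝ) (f₀ f u₀ : 𝕋³ → E³) (p₀ : 𝕋³ → ℝ) (c : ℝ),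
      0 < ν → ν ≤ 1 → 0 ≤ C → 0 ≤ M →
      IsSmooth f₀ → HasZeroMean f₀ → IsSmooth f → IsDivFree f → HasZeroMean f →
      IsSmooth u₀ → IsSmooth p₀ → IsDivFree u₀ → HasZeroMean u₀ → |c| ≤ C → (∀ x, ‖u₀ x‖ ≤ C) →
      (∀ (i : Fin 3) x, ‖Torus.partialDeriv i u₀ x‖ ≤ C * ν⁻¹) →
      (∀ x, Torus.convect u₀ u₀ x - ν • Torus.laplacian u₀ x + Torus.gradient p₀ x -
          c • Torus.partialDeriv (2 : Fin 3) u₀ x = f₀ x) →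
      (∀ (v : 𝕋³ → E³) (r : 𝕋³ → ℝ) (b : ℝ), IsSmooth v → IsSmooth r → IsDivFree v → HasZeroMean v →
      MeasureTheory.integral MeasureTheory.volume (fun x => ‖v x‖ ^ 2) + b ^ 2 ≤
        M ^ 2 * (MeasureTheory.integral MeasureTheory.volume (fun x =>
          ‖Torus.convect u₀ v x + Torus.convect v u₀ x - ν • Torus.laplacian v x + Torus.gradient r x -
            c • Torus.partialDeriv (2 : Fin 3) v x - b • Torus.partialDeriv (2 : Fin 3) u₀ x‖ ^ 2) +
          (MeasureTheory.integral MeasureTheory.volume (fun x =>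
            inner ℝ (v x) (Torus.partialDeriv (2 : Fin 3) u₀ x))) ^ 2)) →
      MeasureTheory.integral MeasureTheory.volume (fun x => ‖f x - f₀ x‖ ^ 2) ≤
        ((A * (1 + M) ^ k * (1 + C) ^ k * ν⁻¹ ^ k) ^ 4)⁻¹ →
      ∃ (u : 𝕋³ → E³) (p : 𝕋³ → ℝ) (c' : ℝ), IsSmooth u ∧ IsSmooth p ∧ IsDivFree u ∧ HasZeroMean u ∧
        (∀ x, Torus.convect u u x - ν • Torus.laplacian u x + Torus.gradient p x -
            c' • Torus.partialDeriv (2 : Fin 3) u x = f x) ∧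
        MeasureTheory.integral MeasureTheory.volume (fun x => ‖u x - u₀ x‖ ^ 2) +
            gradNormSq (fun x => u x - u₀ x) + (c' - c) ^ 2 ≤
          (A * (1 + M) ^ k * (1 + C) ^ k * ν⁻¹ ^ k) ^ 2 *
            MeasureTheory.integral MeasureTheory.volume (fun x => ‖f x - f₀ x‖ ^ 2) := by
  intro hFred hNewt
  -- §0 universal objects: the state space, the bilinear map and its bound, the drift direction `e₃`
  obtain ⟨W, hW, hWc⟩ := exists_space
  haveI : CompleteSpace W := completeSpace_W hWc
  obtain ⟨B, hB, hBb⟩ := exists_bilinear hW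
  obtain ⟨CB, hCB, hBbound⟩ := hBb.bound
  have hBbound' : ∀ x y : W, ‖B x y‖ ≤ CB * ‖x‖ * ‖y‖ := fun x y => hBbound x y
  set M₃ : EuclideanSpace ℂ (Fin 3) := complexify (EuclideanSpace.single (2 : Fin 3) (1 : ℝ)) with hM₃
  have hM₃c : conjVec M₃ = M₃ := by
    rw [hM₃]; exact conjVec_complexify _
  obtain ⟨D₃, hD₃', hD₃c⟩ := exists_drift hW hWc hM₃c
  have hkM : ∀ k : Fin 3 → ℤ, kdot[k, M₃] = ((k (2 : Fin 3) : ℤ) : ℂ) := by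
    intro k
    simp [hM₃, Fin.sum_univ_three, complexify_apply]
  have hD₃ : ∀ x : W, cw[D₃ x] = fun k => (2 * Real.pi * Complex.I * ((k (2 : Fin 3) : ℤ) : ℂ)) • cf[cw[x]] k := by
    intro x; rw [hD₃']; funext k; rw [hkM k]
  -- the universal constants
  obtain ⟨k₁, A₁, hA₁, hL3⟩ := hL3
  set Lip : ℝ := 2 * CB + 2 * ‖D₃‖ with hLip
  have hLip0 : 0 ≤ Lip := by positivity
  refine ⟨k₁, A₁ * (16 * Lip + 48), by positivity, ?_⟩
  intro ν C M f₀ f u₀ p₀ c hν hν1 hC hM hf₀ hf₀m hf hfd hfm hu₀ hp₀ hu₀d hu₀m hcC hsup₀ hsup₁ heq hBB hsmall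
  have hν0 : ν ≠ 0 := hν.ne'
  set P₁ : ℝ := A₁ * (1 + M) ^ k₁ * (1 + C) ^ k₁ * ν⁻¹ ^ k₁ with hP₁
  have hP₁pos : 0 < P₁ := by positivity
  have hPhyp : A₁ * (16 * Lip + 48) * (1 + M) ^ k₁ * (1 + C) ^ k₁ * ν⁻¹ ^ k₁ = (16 * Lip + 48) * P₁ := by
    rw [hP₁]; ring
  rw [hPhyp] at hsmall ⊢
  set I : ℝ := MeasureTheory.integral MeasureTheory.volume (fun x => ‖f x - f₀ x‖ ^ 2) with hI
  have hI0 : 0 ≤ I := MeasureTheory.integral_nonneg fun _ => sq_nonneg _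
  -- §1 the dictionary: base point, forces
  obtain ⟨hD1, hD2, hD3f⟩ := hL1 hW hB hD₃
  have hst₀ : FluidPDE.Torus.IsSteadyNSState ν f₀
      (fun x => u₀ x - c • EuclideanSpace.single (2 : Fin 3) (1 : ℝ)) p₀ :=
    (hDA ν f₀ u₀ p₀ c hu₀ hp₀ hu₀d hu₀m heq).1
  obtain ⟨x₀, hx₀, hGx₀⟩ := hD1 ν f₀ u₀ p₀ c hν hf₀ hf₀m hu₀ hu₀d hu₀m hst₀
  obtain ⟨Fw, F₀w, hFw, hF₀w, hFdist⟩ := hD3f f f₀ hf hfm hf₀ hf₀m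
  have hx₀r : RapidDecay cf[cw[x₀]] := by
    rw [hx₀]; exact hu₀.complexify_comp.rapidDecay_mFourierCoeff
  set a : ℝ := 4 * Real.pi ^ 2 * ν with ha
  have ha0 : a ≠ 0 := by positivity
  have hbase : a • x₀ - c • D₃ x₀ + B x₀ x₀ = F₀w := by
    refine Subtype.ext (lp.ext (funext fun k => ?_))
    have h1 := hGx₀ k
    have h2 := hF₀w k
    rw [← h2] at h1
    exact h1
  -- §2 the border functional `ℓ h = Re Σ ⟪ȟ(k), (∂₃u₀)^(k)⟫`
  have hmem : Memℓp (cf[cw[D₃ x₀]]) 2 := by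
    refine memℓp_two_of_tsum_ne_top (ne_top_of_le_ne_top (l2_tsum_enorm_sq_ne_top ((D₃ x₀ : W) : ℓ2)) ?_)
    exact ENNReal.tsum_le_tsum fun k => by
      refine pow_le_pow_left' ?_ 2
      rw [← ofReal_norm, ← ofReal_norm]
      exact ENNReal.ofReal_le_ofReal (norm_cf_le _ k)
  set y₁ : ℓ2 := ⟨cf[cw[D₃ x₀]], hmem⟩ with hy₁
  have hy₁c : cw[y₁] = cf[cw[D₃ x₀]] := rfl
  set ℓl : W →ₗ[ℝ] ℝ :=
    { toFun := fun h => (inner ℂ y₁ ((h : W) : ℓ2)).re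
      map_add' := fun h h' => by
        simp only [Submodule.coe_add, inner_add_right, Complex.add_re]
      map_smul' := fun r h => by
        simp only [Submodule.coe_smul, RingHom.id_apply, smul_eq_mul]
        rw [RCLike.real_smul_eq_coe_smul (K := ℂ) r, inner_smul_right]
        exact Complex.re_ofReal_mul r _ } with hℓl
  have hℓlb : ∀ h : W, ‖ℓl h‖ ≤ ‖y₁‖ * ‖h‖ := by
    intro h
    change ‖(inner ℂ y₁ ((h : W) : ℓ2)).re‖ ≤ ‖y₁‖ * ‖h‖
    refine (Complex.abs_re_le_norm _).trans ?_
    rw [← norm_coeW]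
    exact norm_inner_le_norm _ _
  set ℓ : W →L[ℝ] ℝ := ℓl.mkContinuous ‖y₁‖ hℓlb with hℓdef
  have hℓapply : ∀ h : W, ℓ h = (inner ℂ y₁ ((h : W) : ℓ2)).re := fun h => rfl
  have hℓ : ∀ h : W, ℓ h = ∑' k : Fin 3 → ℤ, (inner ℂ (cf[cw[h]] k) (cw[D₃ x₀] k)).re := by
    intro h
    rw [hℓapply, lp.inner_eq_tsum, Complex.re_tsum (lp.summable_inner _ _)]
    refine tsum_congr fun k => ?_
    change (inner ℂ (cw[y₁] k) (cw[h] k)).re = (inner ℂ (cf[cw[h]] k) (cw[D₃ x₀] k)).re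
    rw [hy₁c, cf_apply, cf_apply, inner_smul_left, inner_smul_left, Complex.conj_ofReal,
      ← inner_conj_symm (cw[h] k) (cw[D₃ x₀] k), Complex.re_ofReal_mul, Complex.re_ofReal_mul, Complex.conj_re]
  -- §3 the bordered linearisation: compact perturbation of `a·1`, injective with a quantitative bound
  set K : W →L[ℝ] W := (hBb.deriv (x₀, x₀)).comp ((ContinuousLinearMap.id ℝ W).prod (ContinuousLinearMap.id ℝ W))
    with hK
  have hKw : ∀ w, K w = B x₀ w + B w x₀ := fun w => by simp [hK, IsBoundedBilinearMap.deriv_apply]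
  have hKc : IsCompactOperator K := isCompactOperator_linearised hWc hB x₀ hx₀r K hKw
  set K' : W →L[ℝ] W := K - c • D₃ with hK'
  have hK'w : ∀ w, K' w = B x₀ w + B w x₀ - c • D₃ w := fun w => by
    simp [hK', hKw]
  have hK'c : IsCompactOperator K' := by
    have h := hKc.sub (hD₃c.smul c)
    have e : ((K' : W →L[ℝ] W) : W → W) = (K : W → W) - (c • (D₃ : W → W)) := by
      funext w; simp [hK']
    rwa [e]
  have hapr := hL2 hW hB hD₃ ν c M u₀ x₀ ℓ hν hu₀ hu₀d hu₀m hx₀ hℓ hBB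
  have hell := hL3 hW hB hBb hD₃ ν c M C u₀ x₀ ℓ hν hν1 hM hC hu₀ hu₀d hu₀m hcC hsup₀ hsup₁ hx₀ hapr
  rw [← hP₁] at hell
  have hform : ∀ (h : W) (t : ℝ), a • h - c • D₃ h + B x₀ h + B h x₀ - t • D₃ x₀ = a • h + K' h - t • D₃ x₀ := by
    intro h t; rw [hK'w]; abel
  have hinj : ∀ (x : W) (t : ℝ), a • x + K' x - t • D₃ x₀ = 0 → ℓ x = 0 → x = 0 ∧ t = 0 := by
    intro x t h1 h2
    have h := hell x t
    rw [hform, h1, h2, norm_zero, abs_zero, add_zero, mul_zero] at h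
    constructor
    · exact norm_eq_zero.1 (le_antisymm (by linarith [abs_nonneg t]) (norm_nonneg _))
    · exact abs_eq_zero.1 (le_antisymm (by linarith [norm_nonneg x]) (abs_nonneg _))
  obtain ⟨Aeq, hAeq⟩ := hFred K' hK'c a ha0 (D₃ x₀) ℓ hinj
  have hAform : ∀ (h : W) (η : ℝ), Aeq (h, η) = (a • h - c • D₃ h - η • D₃ x₀ + B x₀ h + B h x₀, ℓ h) := by
    intro h η
    rw [hAeq, hK'w]
    ext1
    · change a • h + (B x₀ h + B h x₀ - c • D₃ h) - η • D₃ x₀ = a • h - c • D₃ h - η • D₃ x₀ + B x₀ h + B h x₀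
      abel
    · rfl
  -- the inverse bound `‖A⁻¹‖ ≤ 2 P₁`
  have hinv : ‖(Aeq.symm : (W × ℝ) →L[ℝ] (W × ℝ))‖ ≤ 2 * P₁ := by
    refine ContinuousLinearMap.opNorm_le_bound _ (by positivity) fun y => ?_
    have hy : Aeq (Aeq.symm y) = y := Aeq.apply_symm_apply y
    set h : W := (Aeq.symm y).1 with hh
    set η : ℝ := (Aeq.symm y).2 with hη
    have hpair : Aeq.symm y = (h, η) := rfl
    rw [hpair, hAform] at hy
    have h1 : a • h - c • D₃ h - η • D₃ x₀ + B x₀ h + B h x₀ = y.1 := congrArg Prod.fst hy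
    have h2 : ℓ h = y.2 := congrArg Prod.snd hy
    have hb := hell h η
    rw [show a • h - c • D₃ h + B x₀ h + B h x₀ - η • D₃ x₀ = y.1 by rw [← h1]; abel, h2] at hb
    have hfst : ‖y.1‖ ≤ ‖y‖ := norm_fst_le y
    have hsnd : |y.2| ≤ ‖y‖ := by rw [← Real.norm_eq_abs]; exact norm_snd_le y
    calc ‖(Aeq.symm : (W × ℝ) →L[ℝ] (W × ℝ)) y‖ = ‖((h, η) : W × ℝ)‖ := by
          rw [ContinuousLinearEquiv.coe_coe, hpair]
      _ = max ‖h‖ ‖η‖ := rfl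
      _ ≤ ‖h‖ + |η| := max_le (le_add_of_nonneg_right (abs_nonneg _))
          (by rw [Real.norm_eq_abs]; linarith [norm_nonneg h])
      _ ≤ P₁ * (‖y.1‖ + |y.2|) := hb
      _ ≤ P₁ * (‖y‖ + ‖y‖) := by gcongr
      _ = 2 * P₁ * ‖y‖ := by ring
  -- §4 the Newton step
  have hρ : ‖a • x₀ - c • D₃ x₀ + B x₀ x₀ - Fw‖ ≤ Real.sqrt I := by
    rw [hbase, norm_sub_rev]
    calc ‖Fw - F₀w‖ = Real.sqrt (‖Fw - F₀w‖ ^ 2) := (Real.sqrt_sq (norm_nonneg _)).symm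
      _ ≤ Real.sqrt I := Real.sqrt_le_sqrt hFdist
  have hρ0 : 0 ≤ ‖a • x₀ - c • D₃ x₀ + B x₀ x₀ - Fw‖ := norm_nonneg _
  have hPbig : 0 < (16 * Lip + 48) * P₁ := by positivity
  have hsqrtI : Real.sqrt I ≤ (((16 * Lip + 48) * P₁) ^ 2)⁻¹ := by
    have h1 : Real.sqrt I ≤ Real.sqrt ((((16 * Lip + 48) * P₁) ^ 4)⁻¹) := Real.sqrt_le_sqrt hsmall
    have h2 : Real.sqrt ((((16 * Lip + 48) * P₁) ^ 4)⁻¹) = (((16 * Lip + 48) * P₁) ^ 2)⁻¹ := by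
      rw [Real.sqrt_inv, show ((16 * Lip + 48) * P₁) ^ 4 = ((((16 * Lip + 48) * P₁) ^ 2)) ^ 2 by ring,
        Real.sqrt_sq (by positivity)]
    rw [h2] at h1
    exact h1
  have hprem : 4 * (2 * CB + 2 * ‖D₃‖) * (2 * P₁) * ((2 * P₁) * ‖a • x₀ - c • D₃ x₀ + B x₀ x₀ - Fw‖) ≤ 1 := by
    rw [← hLip]
    have hρ' : ‖a • x₀ - c • D₃ x₀ + B x₀ x₀ - Fw‖ ≤ (((16 * Lip + 48) * P₁) ^ 2)⁻¹ := hρ.trans hsqrtI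
    calc 4 * Lip * (2 * P₁) * ((2 * P₁) * ‖a • x₀ - c • D₃ x₀ + B x₀ x₀ - Fw‖)
        = (16 * Lip * P₁ ^ 2) * ‖a • x₀ - c • D₃ x₀ + B x₀ x₀ - Fw‖ := by ring
      _ ≤ (16 * Lip * P₁ ^ 2) * (((16 * Lip + 48) * P₁) ^ 2)⁻¹ :=
          mul_le_mul_of_nonneg_left hρ' (by positivity)
      _ = (16 * Lip) / (16 * Lip + 48) ^ 2 := by
          field_simp
      _ ≤ 1 := by
          rw [div_le_one (by positivity)]
          nlinarith
  obtain ⟨x, β, hzero, -, hxclose, hβclose⟩ :=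
    hNewt B CB hBb hCB.le hBbound' D₃ ℓ a Fw x₀ c (2 * P₁) Aeq hAform hinv hprem
  -- §5 synthesis of the classical drifted steady state
  have hxeq : ∀ k : Fin 3 → ℤ, cw[((4 * Real.pi ^ 2 * ν) • x - β • D₃ x + B x x : W)] k =
      FluidPDE.Torus.lerayCoeff k (mFourierCoeff (complexify ∘ f) k) := by
    intro k; rw [← ha, hzero, hFw k]
  obtain ⟨u, p, hu, hp, hud, hum, hueq, hû⟩ := hD2 ν f x β hν hf hfd hfm hxeq
  refine ⟨u, p, β, hu, hp, hud, hum, hueq, ?_⟩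
  -- §6 the `H¹` estimate
  have hcoef : mFourierCoeff (complexify ∘ fun y => u y - u₀ y) = cf[cw[((x - x₀ : W))]] := by
    have e : (complexify ∘ fun y => u y - u₀ y : 𝕋³ → EuclideanSpace ℂ (Fin 3)) =
        (complexify ∘ u) - (complexify ∘ u₀) := by
      funext y; simp
    rw [e, coeW_sub]
    funext k
    rw [mFourierCoeff_sub hu.complexify_comp.integrable hu₀.complexify_comp.integrable, hû, ← hx₀]
    simp only [Pi.smul_apply', Pi.sub_apply, smul_sub]
  have hv : IsSmooth (fun y => u y - u₀ y) := hu.sub hu₀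
  have hH := h1_le_of_coeff hv ((x - x₀ : W) : ℓ2) hcoef
  rw [norm_coeW] at hH
  set ρ : ℝ := ‖a • x₀ - c • D₃ x₀ + B x₀ x₀ - Fw‖ with hρdef
  have hρI : ρ ^ 2 ≤ I := by
    calc ρ ^ 2 ≤ (Real.sqrt I) ^ 2 := pow_le_pow_left₀ hρ0 hρ 2
      _ = I := Real.sq_sqrt hI0
  have hx1 : ‖x - x₀‖ ^ 2 ≤ (4 * P₁ * ρ) ^ 2 := by
    refine pow_le_pow_left₀ (norm_nonneg _) ?_ 2
    calc ‖x - x₀‖ ≤ 2 * (2 * P₁) * ρ := hxclose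
      _ = 4 * P₁ * ρ := by ring
  have hβ1 : (β - c) ^ 2 ≤ (4 * P₁ * ρ) ^ 2 := by
    rw [← sq_abs]
    refine pow_le_pow_left₀ (abs_nonneg _) ?_ 2
    calc |β - c| ≤ 2 * (2 * P₁) * ρ := hβclose
      _ = 4 * P₁ * ρ := by ring
  have hpi : Real.pi ^ 2 ≤ 16 := by nlinarith [Real.pi_lt_four, Real.pi_pos]
  have hLipP : (2 + 4 * Real.pi ^ 2) * 16 ≤ (16 * Lip + 48) ^ 2 := by nlinarith
  calc MeasureTheory.integral MeasureTheory.volume (fun y => ‖u y - u₀ y‖ ^ 2) +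
        gradNormSq (fun y => u y - u₀ y) + (β - c) ^ 2
      ≤ (1 + 4 * Real.pi ^ 2) * ‖x - x₀‖ ^ 2 + (β - c) ^ 2 := by linarith
    _ ≤ (1 + 4 * Real.pi ^ 2) * (4 * P₁ * ρ) ^ 2 + (4 * P₁ * ρ) ^ 2 := by gcongr
    _ = ((2 + 4 * Real.pi ^ 2) * 16) * P₁ ^ 2 * ρ ^ 2 := by ring
    _ ≤ (16 * Lip + 48) ^ 2 * P₁ ^ 2 * I := by gcongr
    _ = ((16 * Lip + 48) * P₁) ^ 2 * I := by ring


/-! ## The composition, part 2: `C⁺ → CalculusFacts → DriftAbsorption → NewtonRealisation` (from `SketchIdeator1R1.lean`) -/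

/-- Power-counting lemma (the only asymptotics in the composition): with `m = k(K₀+1)`,
`A(1 + |C₀|ν^{-K₀})^k(1+C)^kν^{-k} · ν^m ≤ A(1+|C₀|)^k(1+C)^k` for `0 < ν ≤ 1`. -/
theorem persistenceConstant_mul_pow_le {A C C₀ ν : ℝ} {k K₀ : ℕ} (hA : 0 ≤ A) (hC : 0 ≤ C)
    (hν : 0 < ν) (hν1 : ν ≤ 1) :
    A * (1 + |C₀| * ν⁻¹ ^ K₀) ^ k * (1 + C) ^ k * ν⁻¹ ^ k * ν ^ (k * (K₀ + 1)) ≤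
      A * (1 + |C₀|) ^ k * (1 + C) ^ k := by
  have hν0 : ν ≠ 0 := hν.ne'
  have hbase : (1 + |C₀| * ν⁻¹ ^ K₀) * ν⁻¹ * ν ^ (K₀ + 1) = ν ^ K₀ + |C₀| := by
    have h1 : ν⁻¹ ^ K₀ * ν ^ K₀ = 1 := by rw [← mul_pow, inv_mul_cancel₀ hν0, one_pow]
    have h2 : ν⁻¹ * ν = 1 := inv_mul_cancel₀ hν0
    calc (1 + |C₀| * ν⁻¹ ^ K₀) * ν⁻¹ * ν ^ (K₀ + 1)
        = (ν ^ K₀ + |C₀| * (ν⁻¹ ^ K₀ * ν ^ K₀)) * (ν⁻¹ * ν) := by rw [pow_succ]; ring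
      _ = ν ^ K₀ + |C₀| := by rw [h1, h2]; ring
  have hpow : ν ^ (k * (K₀ + 1)) = (ν ^ (K₀ + 1)) ^ k := by rw [mul_comm, pow_mul]
  have hle : ν ^ K₀ + |C₀| ≤ 1 + |C₀| := by
    have : ν ^ K₀ ≤ 1 := pow_le_one₀ hν.le hν1
    linarith
  have hnn : 0 ≤ ν ^ K₀ + |C₀| := by positivity
  calc A * (1 + |C₀| * ν⁻¹ ^ K₀) ^ k * (1 + C) ^ k * ν⁻¹ ^ k * ν ^ (k * (K₀ + 1))
      = A * (1 + C) ^ k * ((1 + |C₀| * ν⁻¹ ^ K₀) * ν⁻¹ * ν ^ (K₀ + 1)) ^ k := by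
        rw [hpow, mul_pow, mul_pow]; ring
    _ = A * (1 + C) ^ k * (ν ^ K₀ + |C₀|) ^ k := by rw [hbase]
    _ ≤ A * (1 + C) ^ k * (1 + |C₀|) ^ k := by
        gcongr
    _ = A * (1 + |C₀|) ^ k * (1 + C) ^ k := by ring

set_option maxHeartbeats 1600000 in
/-- **The per-viscosity step of the force-side composition** (one selected `n`; all thresholds as hypotheses):
from C⁺ (with its constants `k, A`), the calculus facts, drift absorption and the crux's data at ONE state — an order
`K = 4k(K₀+1)+3` quasi-steady state `(w, q, c)` at viscosity `ν` below the five thresholds — produce the classical steady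
solution with energy `≤ 2E + 2 + (C''+1)²` and dissipation `≥ ε₀/2`. -/
theorem perStep {k : ℕ} {A : ℝ}
    (hP : ∀ (ν C M : ℝ) (f₀ f u₀ : 𝕋³ → E³) (p₀ : 𝕋³ → ℝ) (c : ℝ),
      0 < ν → ν ≤ 1 → 0 ≤ C → 0 ≤ M →
      IsSmooth f₀ → HasZeroMean f₀ → IsSmooth f → IsDivFree f → HasZeroMean f →
      IsSmooth u₀ → IsSmooth p₀ → IsDivFree u₀ → HasZeroMean u₀ → |c| ≤ C → (∀ x, ‖u₀ x‖ ≤ C) →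
      (∀ (i : Fin 3) x, ‖Torus.partialDeriv i u₀ x‖ ≤ C * ν⁻¹) →
      (∀ x, Torus.convect u₀ u₀ x - ν • Torus.laplacian u₀ x + Torus.gradient p₀ x -
          c • Torus.partialDeriv (2 : Fin 3) u₀ x = f₀ x) →
      (∀ (v : 𝕋³ → E³) (r : 𝕋³ → ℝ) (b : ℝ), IsSmooth v → IsSmooth r → IsDivFree v → HasZeroMean v →
      MeasureTheory.integral MeasureTheory.volume (fun x => ‖v x‖ ^ 2) + b ^ 2 ≤
        M ^ 2 * (MeasureTheory.integral MeasureTheory.volume (fun x =>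
          ‖Torus.convect u₀ v x + Torus.convect v u₀ x - ν • Torus.laplacian v x + Torus.gradient r x -
            c • Torus.partialDeriv (2 : Fin 3) v x - b • Torus.partialDeriv (2 : Fin 3) u₀ x‖ ^ 2) +
          (MeasureTheory.integral MeasureTheory.volume (fun x =>
            inner ℝ (v x) (Torus.partialDeriv (2 : Fin 3) u₀ x))) ^ 2)) →
      MeasureTheory.integral MeasureTheory.volume (fun x => ‖f x - f₀ x‖ ^ 2) ≤
        ((A * (1 + M) ^ k * (1 + C) ^ k * ν⁻¹ ^ k) ^ 4)⁻¹ →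
      ∃ (u : 𝕋³ → E³) (p : 𝕋³ → ℝ) (c' : ℝ), IsSmooth u ∧ IsSmooth p ∧ IsDivFree u ∧ HasZeroMean u ∧
        (∀ x, Torus.convect u u x - ν • Torus.laplacian u x + Torus.gradient p x -
            c' • Torus.partialDeriv (2 : Fin 3) u x = f x) ∧
        MeasureTheory.integral MeasureTheory.volume (fun x => ‖u x - u₀ x‖ ^ 2) +
            gradNormSq (fun x => u x - u₀ x) + (c' - c) ^ 2 ≤
          (A * (1 + M) ^ k * (1 + C) ^ k * ν⁻¹ ^ k) ^ 2 *
            MeasureTheory.integral MeasureTheory.volume (fun x => ‖f x - f₀ x‖ ^ 2))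
    (hF1 : ∀ (ν : ℝ) (w : 𝕋³ → E³) (q : 𝕋³ → ℝ) (c : ℝ), IsSmooth w → IsDivFree w → IsSmooth q →
      IsSmooth (fun x => Torus.convect w w x - ν • Torus.laplacian w x + Torus.gradient q x -
          c • Torus.partialDeriv (2 : Fin 3) w x) ∧
        HasZeroMean (fun x => Torus.convect w w x - ν • Torus.laplacian w x + Torus.gradient q x -
          c • Torus.partialDeriv (2 : Fin 3) w x))
    (hF2 : ∀ (u v : 𝕋³ → E³), IsSmooth u → IsSmooth v →
      Real.sqrt (gradNormSq v) ≤ Real.sqrt (gradNormSq u) + Real.sqrt (gradNormSq (fun x => u x - v x)) ∧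
      MeasureTheory.integral MeasureTheory.volume (fun x => ‖u x‖ ^ 2) ≤
        2 * MeasureTheory.integral MeasureTheory.volume (fun x => ‖v x‖ ^ 2) +
          2 * MeasureTheory.integral MeasureTheory.volume (fun x => ‖u x - v x‖ ^ 2))
    (hD : ∀ (ν : ℝ) (f W : 𝕋³ → E³) (Q : 𝕋³ → ℝ) (c' : ℝ), IsSmooth W → IsSmooth Q → IsDivFree W →
      HasZeroMean W →
      (∀ x, Torus.convect W W x - ν • Torus.laplacian W x + Torus.gradient Q x -
          c' • Torus.partialDeriv (2 : Fin 3) W x = f x) →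
      IsClassicalNSSolutionOn Set.univ ν (fun _ => f)
          (fun _ x => W x - c' • EuclideanSpace.single (2 : Fin 3) (1 : ℝ)) (fun _ => Q) ∧
        gradNormSq (fun x => W x - c' • EuclideanSpace.single (2 : Fin 3) (1 : ℝ)) = gradNormSq W ∧
        MeasureTheory.integral MeasureTheory.volume
            (fun x => ‖W x - c' • EuclideanSpace.single (2 : Fin 3) (1 : ℝ)‖ ^ 2) =
          MeasureTheory.integral MeasureTheory.volume (fun x => ‖W x‖ ^ 2) + c' ^ 2)
    (hA : 0 < A) {C C₀ E ε₀ ν cc : ℝ} {K₀ : ℕ} (hC'' : 0 ≤ max C 0) (hCC'' : C ≤ max C 0)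
    (_hA' : 0 < A * (1 + |C₀|) ^ k * (1 + max C 0) ^ k) (hC1 : 0 < max C 0 + 1) (hε₀ : 0 < ε₀)
    {f w : 𝕋³ → E³} {q : 𝕋³ → ℝ} (hf : IsSmooth f) (hfd : IsDivFree f) (hfm : HasZeroMean f)
    (hν : 0 < ν) (hν1 : ν ≤ 1)
    (hν2 : ν < ((A * (1 + |C₀|) ^ k * (1 + max C 0) ^ k) ^ 4 * (max C 0 + 1))⁻¹)
    (hν3 : ν < ((A * (1 + |C₀|) ^ k * (1 + max C 0) ^ k) ^ 2 * (max C 0 + 1))⁻¹)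
    (hν4 : ν < (ε₀ / (8 * (max C 0 + 1))) ^ 2) (hν5 : ν < ε₀ / 24)
    (hw : IsSmooth w) (hq : IsSmooth q) (hwd : IsDivFree w) (hwm : HasZeroMean w) (hcC : |cc| ≤ C)
    (hwE : MeasureTheory.integral MeasureTheory.volume (fun x => ‖w x‖ ^ 2) ≤ E)
    (hdiss : |ν * gradNormSq w - ε₀| ≤ C * Real.sqrt ν)
    (hres : MeasureTheory.integral MeasureTheory.volume (fun x =>
        ‖Torus.convect w w x - ν • Torus.laplacian w x + Torus.gradient q x -
          cc • Torus.partialDeriv (2 : Fin 3) w x - f x‖ ^ 2) ≤ C * ν ^ (4 * (k * (K₀ + 1)) + 3))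
    (hsup₀ : ∀ x, ‖w x‖ ≤ C) (hsup₁ : ∀ (i : Fin 3) x, ‖Torus.partialDeriv i w x‖ ≤ C * ν⁻¹)
    (hap : ∀ (v : 𝕋³ → E³) (r : 𝕋³ → ℝ) (b : ℝ), IsSmooth v → IsSmooth r → IsDivFree v → HasZeroMean v →
      MeasureTheory.integral MeasureTheory.volume (fun x => ‖v x‖ ^ 2) + b ^ 2 ≤
        (C₀ * ν⁻¹ ^ K₀) ^ 2 * (MeasureTheory.integral MeasureTheory.volume (fun x =>
          ‖Torus.convect w v x + Torus.convect v w x - ν • Torus.laplacian v x + Torus.gradient r x -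
            cc • Torus.partialDeriv (2 : Fin 3) v x - b • Torus.partialDeriv (2 : Fin 3) w x‖ ^ 2) +
          (MeasureTheory.integral MeasureTheory.volume (fun x =>
            inner ℝ (v x) (Torus.partialDeriv (2 : Fin 3) w x))) ^ 2)) :
    ∃ (u : 𝕋³ → E³) (p : 𝕋³ → ℝ),
      IsClassicalNSSolutionOn Set.univ ν (fun _ => f) (fun _ => u) (fun _ => p) ∧
        MeasureTheory.integral MeasureTheory.volume (fun x => ‖u x‖ ^ 2) ≤ 2 * E + 2 + (max C 0 + 1) ^ 2 ∧
        ε₀ / 2 ≤ ν * gradNormSq u := by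
  have hν0 : ν ≠ 0 := hν.ne'
  -- the exact force `f₀` of the quasi-steady state (smooth, mean zero) and the exact equation
  obtain ⟨hf₀s, hf₀m⟩ := hF1 ν w q cc hw hwd hq
  -- the bordered bound with `M = |C₀| ν^{-K₀}`
  have hM : 0 ≤ |C₀| * ν⁻¹ ^ K₀ := by positivity
  have hBB : (∀ (v : 𝕋³ → E³) (r : 𝕋³ → ℝ) (b : ℝ), IsSmooth v → IsSmooth r → IsDivFree v → HasZeroMean v →
      MeasureTheory.integral MeasureTheory.volume (fun x => ‖v x‖ ^ 2) + b ^ 2 ≤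
        (|C₀| * ν⁻¹ ^ K₀) ^ 2 * (MeasureTheory.integral MeasureTheory.volume (fun x =>
          ‖Torus.convect w v x + Torus.convect v w x - ν • Torus.laplacian v x + Torus.gradient r x -
            cc • Torus.partialDeriv (2 : Fin 3) v x - b • Torus.partialDeriv (2 : Fin 3) w x‖ ^ 2) +
          (MeasureTheory.integral MeasureTheory.volume (fun x =>
            inner ℝ (v x) (Torus.partialDeriv (2 : Fin 3) w x))) ^ 2)) := by
    intro v r b hv hr hvd hvm
    have h := hap v r b hv hr hvd hvm
    have hsq : (|C₀| * ν⁻¹ ^ K₀) ^ 2 = (C₀ * ν⁻¹ ^ K₀) ^ 2 := by rw [mul_pow, mul_pow, sq_abs]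
    rw [hsq]
    exact h
  -- the persistence constant `P` and its power-counting bound `P ν^m ≤ A'`
  have hPpos : 0 < A * (1 + |C₀| * ν⁻¹ ^ K₀) ^ k * (1 + max C 0) ^ k * ν⁻¹ ^ k := by positivity
  have hPm : A * (1 + |C₀| * ν⁻¹ ^ K₀) ^ k * (1 + max C 0) ^ k * ν⁻¹ ^ k * ν ^ (k * (K₀ + 1)) ≤
      A * (1 + |C₀|) ^ k * (1 + max C 0) ^ k :=
    persistenceConstant_mul_pow_le hA.le hC'' hν hν1
  have hPm0 : 0 ≤ A * (1 + |C₀| * ν⁻¹ ^ K₀) ^ k * (1 + max C 0) ^ k * ν⁻¹ ^ k * ν ^ (k * (K₀ + 1)) := by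
    positivity
  -- abbreviations (plain `have`-level names via `generalize`-free `set`)
  set P : ℝ := A * (1 + |C₀| * ν⁻¹ ^ K₀) ^ k * (1 + max C 0) ^ k * ν⁻¹ ^ k with hP_def
  set A' : ℝ := A * (1 + |C₀|) ^ k * (1 + max C 0) ^ k with hA'_def
  set m : ℕ := k * (K₀ + 1) with hm_def
  -- sup bounds with `C'' = max C 0`
  have hcC'' : |cc| ≤ max C 0 := le_trans hcC hCC''
  have hsup₀'' : ∀ x, ‖w x‖ ≤ max C 0 := fun x => le_trans (hsup₀ x) hCC''
  have hsup₁'' : ∀ (i : Fin 3) x, ‖Torus.partialDeriv i w x‖ ≤ max C 0 * ν⁻¹ := fun i x =>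
    le_trans (hsup₁ i x) (mul_le_mul_of_nonneg_right hCC'' (inv_nonneg.2 hν.le))
  -- the residual, read as `‖f − f₀‖²`
  have hres' : MeasureTheory.integral MeasureTheory.volume (fun x => ‖f x -
      (Torus.convect w w x - ν • Torus.laplacian w x + Torus.gradient q x -
        cc • Torus.partialDeriv (2 : Fin 3) w x)‖ ^ 2) ≤ C * ν ^ (4 * m + 3) := by
    have hcongr : (fun x => ‖f x - (Torus.convect w w x - ν • Torus.laplacian w x + Torus.gradient q x -
        cc • Torus.partialDeriv (2 : Fin 3) w x)‖ ^ 2) = fun x => ‖Torus.convect w w x -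
          ν • Torus.laplacian w x + Torus.gradient q x - cc • Torus.partialDeriv (2 : Fin 3) w x -
          f x‖ ^ 2 := by
      funext x
      rw [norm_sub_rev]
    rw [hcongr]
    exact hres
  -- power counting: `ν^K = ν³ (ν^m)^4`
  have hK4 : ν ^ (4 * m + 3) = ν ^ 3 * (ν ^ m) ^ 4 := by
    rw [← pow_mul, ← pow_add]; ring_nf
  have hν3' : ν ^ 3 ≤ ν := by
    have : ν ^ 3 ≤ ν ^ 1 := pow_le_pow_of_le_one hν.le hν1 (by norm_num)
    simpa using this
  have hν32 : ν ^ 3 ≤ ν ^ 2 := pow_le_pow_of_le_one hν.le hν1 (by norm_num)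
  have hνm1 : (ν ^ m) ^ 2 ≤ 1 := pow_le_one₀ (by positivity) (pow_le_one₀ hν.le hν1)
  have hPm4 : (P * ν ^ m) ^ 4 ≤ A' ^ 4 := pow_le_pow_left₀ hPm0 hPm 4
  have hPm2 : (P * ν ^ m) ^ 2 ≤ A' ^ 2 := pow_le_pow_left₀ hPm0 hPm 2
  -- (T1) the Kantorovich premise `C ν^K ≤ P⁻⁴`
  have hT1 : MeasureTheory.integral MeasureTheory.volume (fun x => ‖f x -
      (Torus.convect w w x - ν • Torus.laplacian w x + Torus.gradient q x -
        cc • Torus.partialDeriv (2 : Fin 3) w x)‖ ^ 2) ≤ (P ^ 4)⁻¹ := by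
    have hkey : C * ν ^ (4 * m + 3) * P ^ 4 ≤ 1 := by
      have h1 : C * ν ^ (4 * m + 3) * P ^ 4 = C * (ν ^ 3 * (P * ν ^ m) ^ 4) := by rw [hK4]; ring
      rw [h1]
      have h2 : C * (ν ^ 3 * (P * ν ^ m) ^ 4) ≤ max C 0 * (ν ^ 3 * (P * ν ^ m) ^ 4) :=
        mul_le_mul_of_nonneg_right hCC'' (by positivity)
      have h3 : max C 0 * (ν ^ 3 * (P * ν ^ m) ^ 4) ≤ max C 0 * (ν * A' ^ 4) :=
        mul_le_mul_of_nonneg_left (mul_le_mul hν3' hPm4 (by positivity) hν.le) hC''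
      have h4 : max C 0 * (ν * A' ^ 4) ≤ (max C 0 + 1) * (ν * A' ^ 4) :=
        mul_le_mul_of_nonneg_right (by linarith) (by positivity)
      have h5 : (max C 0 + 1) * (ν * A' ^ 4) < 1 := by
        have hpos : 0 < A' ^ 4 * (max C 0 + 1) := by positivity
        calc (max C 0 + 1) * (ν * A' ^ 4) = ν * (A' ^ 4 * (max C 0 + 1)) := by ring
          _ < (A' ^ 4 * (max C 0 + 1))⁻¹ * (A' ^ 4 * (max C 0 + 1)) :=
              mul_lt_mul_of_pos_right hν2 hpos
          _ = 1 := inv_mul_cancel₀ hpos.ne'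
      linarith
    calc MeasureTheory.integral MeasureTheory.volume (fun x => ‖f x -
          (Torus.convect w w x - ν • Torus.laplacian w x + Torus.gradient q x -
            cc • Torus.partialDeriv (2 : Fin 3) w x)‖ ^ 2)
        ≤ C * ν ^ (4 * m + 3) := hres'
      _ = C * ν ^ (4 * m + 3) * P ^ 4 * (P ^ 4)⁻¹ := by field_simp
      _ ≤ 1 * (P ^ 4)⁻¹ := mul_le_mul_of_nonneg_right hkey (by positivity)
      _ = (P ^ 4)⁻¹ := one_mul _
  -- apply C⁺ at the exact drifted steady state `(w, q, cc)` of the force `f₀`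
  obtain ⟨u, p, c', hu, hp, hud, hum, hueq, hclose⟩ :=
    hP ν (max C 0) (|C₀| * ν⁻¹ ^ K₀) (fun x => Torus.convect w w x - ν • Torus.laplacian w x +
        Torus.gradient q x - cc • Torus.partialDeriv (2 : Fin 3) w x) f w q cc hν hν1 hC'' hM hf₀s hf₀m hf hfd
      hfm hw hq hwd hwm hcC'' hsup₀'' hsup₁'' (fun x => rfl) hBB hT1
  -- (T2) closeness `≤ ν`
  have hT2 : MeasureTheory.integral MeasureTheory.volume (fun x => ‖u x - w x‖ ^ 2) +
      gradNormSq (fun x => u x - w x) + (c' - cc) ^ 2 ≤ ν := by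
    refine le_trans hclose ?_
    have h1 : P ^ 2 * MeasureTheory.integral MeasureTheory.volume (fun x => ‖f x -
        (Torus.convect w w x - ν • Torus.laplacian w x + Torus.gradient q x -
          cc • Torus.partialDeriv (2 : Fin 3) w x)‖ ^ 2) ≤ P ^ 2 * (C * ν ^ (4 * m + 3)) :=
      mul_le_mul_of_nonneg_left hres' (by positivity)
    refine le_trans h1 ?_
    have h2 : P ^ 2 * (C * ν ^ (4 * m + 3)) = C * (ν ^ 3 * (ν ^ m) ^ 2 * (P * ν ^ m) ^ 2) := by
      rw [hK4]; ring
    rw [h2]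
    have h3 : C * (ν ^ 3 * (ν ^ m) ^ 2 * (P * ν ^ m) ^ 2) ≤ max C 0 * (ν ^ 3 * (ν ^ m) ^ 2 * (P * ν ^ m) ^ 2) :=
      mul_le_mul_of_nonneg_right hCC'' (by positivity)
    have h4 : max C 0 * (ν ^ 3 * (ν ^ m) ^ 2 * (P * ν ^ m) ^ 2) ≤ max C 0 * (ν ^ 2 * 1 * A' ^ 2) :=
      mul_le_mul_of_nonneg_left (mul_le_mul (mul_le_mul hν32 hνm1 (by positivity) (by positivity)) hPm2
        (by positivity) (by positivity)) hC''
    have h5 : max C 0 * (ν ^ 2 * 1 * A' ^ 2) ≤ ν * (ν * (A' ^ 2 * (max C 0 + 1))) := by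
      have e : max C 0 * (ν ^ 2 * 1 * A' ^ 2) = ν * (ν * (A' ^ 2 * max C 0)) := by ring
      rw [e]
      have e2 : A' ^ 2 * max C 0 ≤ A' ^ 2 * (max C 0 + 1) :=
        mul_le_mul_of_nonneg_left (by linarith) (by positivity)
      exact mul_le_mul_of_nonneg_left (mul_le_mul_of_nonneg_left e2 hν.le) hν.le
    have h6 : ν * (A' ^ 2 * (max C 0 + 1)) < 1 := by
      have hpos : 0 < A' ^ 2 * (max C 0 + 1) := by positivity
      calc ν * (A' ^ 2 * (max C 0 + 1)) < (A' ^ 2 * (max C 0 + 1))⁻¹ * (A' ^ 2 * (max C 0 + 1)) :=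
            mul_lt_mul_of_pos_right hν3 hpos
        _ = 1 := inv_mul_cancel₀ hpos.ne'
    have h7 : ν * (ν * (A' ^ 2 * (max C 0 + 1))) ≤ ν * 1 := mul_le_mul_of_nonneg_left h6.le hν.le
    linarith
  -- drift absorption
  obtain ⟨hsol, hgrad, hen⟩ := hD ν f u p c' hu hp hud hum hueq
  have hI0 : 0 ≤ MeasureTheory.integral MeasureTheory.volume (fun x => ‖u x - w x‖ ^ 2) :=
    MeasureTheory.integral_nonneg fun _ => sq_nonneg _
  have hg0 : 0 ≤ gradNormSq (fun x => u x - w x) := gradNormSq_nonneg _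
  have hsq0 : 0 ≤ (c' - cc) ^ 2 := sq_nonneg _
  refine ⟨fun x => u x - c' • EuclideanSpace.single (2 : Fin 3) (1 : ℝ), p, hsol, ?_, ?_⟩
  · -- energy
    have hE1 : MeasureTheory.integral MeasureTheory.volume (fun x => ‖u x - w x‖ ^ 2) ≤ 1 := by linarith
    have hcc : (c' - cc) ^ 2 ≤ 1 := by linarith
    have hc'1 : |c'| ≤ max C 0 + 1 := by
      have h1 : |c' - cc| ≤ 1 := by
        have h := Real.sqrt_le_sqrt hcc
        rwa [Real.sqrt_sq_eq_abs, Real.sqrt_one] at h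
      have h2 := abs_sub_abs_le_abs_sub c' cc
      linarith
    have hc'2 : c' ^ 2 ≤ (max C 0 + 1) ^ 2 := by
      refine sq_le_sq.2 ?_
      rw [abs_of_nonneg (by positivity : (0 : ℝ) ≤ max C 0 + 1)]
      exact hc'1
    obtain ⟨-, hsplit⟩ := hF2 u w hu hw
    rw [hen]
    linarith
  · -- dissipation: `‖∇w‖ ≤ ‖∇u‖ + ‖∇(u − w)‖`, `‖∇(u−w)‖² ≤ ν`
    rw [hgrad]
    obtain ⟨hMink, -⟩ := hF2 u w hu hw
    have hgu : 0 ≤ gradNormSq u := gradNormSq_nonneg _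
    have hgw : 0 ≤ gradNormSq w := gradNormSq_nonneg _
    have hguw : gradNormSq (fun x => u x - w x) ≤ ν := by linarith
    have ha0 : 0 ≤ Real.sqrt (gradNormSq u) := Real.sqrt_nonneg _
    have hb0 : 0 ≤ Real.sqrt (gradNormSq (fun x => u x - w x)) := Real.sqrt_nonneg _
    have hs0 : 0 ≤ Real.sqrt (gradNormSq w) := Real.sqrt_nonneg _
    have ha2 : Real.sqrt (gradNormSq u) ^ 2 = gradNormSq u := Real.sq_sqrt hgu
    have hs2 : Real.sqrt (gradNormSq w) ^ 2 = gradNormSq w := Real.sq_sqrt hgw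
    have hb2 : Real.sqrt (gradNormSq (fun x => u x - w x)) ^ 2 ≤ ν := by
      rw [Real.sq_sqrt hg0]; exact hguw
    -- `s² ≤ (a+b)² ≤ (3/2)a² + 3b²`
    have hsq1 : Real.sqrt (gradNormSq w) ^ 2 ≤
        (Real.sqrt (gradNormSq u) + Real.sqrt (gradNormSq (fun x => u x - w x))) ^ 2 :=
      pow_le_pow_left₀ hs0 hMink 2
    have hsq2 : (Real.sqrt (gradNormSq u) + Real.sqrt (gradNormSq (fun x => u x - w x))) ^ 2 ≤
        (3 / 2) * Real.sqrt (gradNormSq u) ^ 2 + 3 * Real.sqrt (gradNormSq (fun x => u x - w x)) ^ 2 := by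
      nlinarith [sq_nonneg (Real.sqrt (gradNormSq u) - 2 * Real.sqrt (gradNormSq (fun x => u x - w x)))]
    have hmain : gradNormSq w ≤ (3 / 2) * gradNormSq u + 3 * ν := by
      rw [← hs2, ← ha2]; linarith
    -- thresholds for the dissipation arithmetic
    have hsqν0 : 0 ≤ Real.sqrt ν := Real.sqrt_nonneg _
    have hsmall : Real.sqrt ν < ε₀ / (8 * (max C 0 + 1)) := by
      calc Real.sqrt ν < Real.sqrt ((ε₀ / (8 * (max C 0 + 1))) ^ 2) := Real.sqrt_lt_sqrt hν.le hν4
        _ = ε₀ / (8 * (max C 0 + 1)) := Real.sqrt_sq (by positivity)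
    have h4 : (max C 0 + 1) * Real.sqrt ν < ε₀ / 8 := by
      calc (max C 0 + 1) * Real.sqrt ν < (max C 0 + 1) * (ε₀ / (8 * (max C 0 + 1))) :=
            mul_lt_mul_of_pos_left hsmall hC1
        _ = ε₀ / 8 := by field_simp
    have h5 : C * Real.sqrt ν ≤ (max C 0 + 1) * Real.sqrt ν :=
      mul_le_mul_of_nonneg_right (by linarith) hsqν0
    have hνsq : ν ^ 2 ≤ ν := by nlinarith
    have hd1 := abs_le.1 hdiss
    have hνgw : ε₀ - C * Real.sqrt ν ≤ ν * gradNormSq w := by linarith [hd1.1, hd1.2]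
    have hνmain : ν * gradNormSq w ≤ (3 / 2) * (ν * gradNormSq u) + 3 * ν ^ 2 := by
      have h := mul_le_mul_of_nonneg_left hmain hν.le
      have e : ν * ((3 / 2) * gradNormSq u + 3 * ν) = (3 / 2) * (ν * gradNormSq u) + 3 * ν ^ 2 := by ring
      linarith
    linarith

set_option maxHeartbeats 1600000 in
/-- **THE FORCE-SIDE COMPOSITION (kernel-checked).**  `QuantBorderedPersistence` (C⁺) + `CalculusFacts` + `DriftAbsorption`
imply the crux `Theses.NeutralTaylorWaves.NewtonRealisation` BY NAME.  Proof: destructure `NonresonantTaylorWaves`; take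
`(k, A)` from C⁺, `m := k(K₀+1)`, `K := 4m + 3`, `C := C_K`, `C'' := max C 0`, `A' := A(1+|C₀|)^k(1+C'')^k`; thresholds
`ν < 1`, `ν < (A'^4(C''+1))⁻¹` (Kantorovich premise `C_Kν^K ≤ P⁻⁴`), `ν < (A'^2(C''+1))⁻¹` (closeness `P²C_Kν^K ≤ ν`),
`ν < (ε₀/(8(C''+1)))²` and `ν < ε₀/24` (dissipation); per selected `n`: the quasi-steady `(w, q, c)` is an EXACT drifted steady
state of `f₀ := w·∇w − νΔw + ∇q − c∂₃w` (by `rfl`), `∫‖f − f₀‖² = residual ≤ C_Kν^K`, C⁺ realises `f`, drift absorption gives the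
classical solution `u − c'e₃`; energy `≤ 2E + 2 + (C''+1)²`, dissipation `≥ ε₀/2` (Minkowski + AM–GM: `‖∇w‖² ≤ (3/2)‖∇u‖² + 3ν`). -/
theorem NewtonRealisation_of :
    __Registered.stub_borderedFredholm → __Registered.stub_quadraticNewton →
      __Registered.stub_latticeDictionary → __Registered.stub_aprioriTransfer → __Registered.stub_ellipticDensity →
        __Registered.stub_calculusFacts → __Registered.stub_driftAbsorption →
          Summit.AnomalousDissipation.AnomalousDissipation.Theses.NeutralTaylorWaves.NewtonRealisation := by
  intro hFr hNw hL1 hL2 hL3 hF hD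
  dsimp only [__Registered.stub_borderedFredholm, __Registered.stub_quadraticNewton,
    __Registered.stub_latticeDictionary, __Registered.stub_aprioriTransfer, __Registered.stub_ellipticDensity,
    __Registered.stub_calculusFacts, __Registered.stub_driftAbsorption] at hFr hNw hL1 hL2 hL3 hF hD
  have hP := quantPersistenceCore_of_lattice hL1 hL2 hL3 hD hFr hNw
  clear hFr hNw hL1 hL2 hL3
  unfold Summit.AnomalousDissipation.AnomalousDissipation.Theses.NeutralTaylorWaves.NewtonRealisation
  intro hX
  unfold Summit.AnomalousDissipation.AnomalousDissipation.Theses.NeutralTaylorWaves.NonresonantTaylorWaves at hX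
  obtain ⟨f, hf, hfd, hfm, ν, E, ε₀, C₀, K₀, hνpos, hνlim, hε₀, hX⟩ := hX
  obtain ⟨k, A, hA, hP⟩ := hP
  obtain ⟨hF1, hF2⟩ := hF
  -- the order `K` and the constants
  obtain ⟨C, hX⟩ := hX (4 * (k * (K₀ + 1)) + 3)
  have hC'' : 0 ≤ max C 0 := le_max_right _ _
  have hCC'' : C ≤ max C 0 := le_max_left _ _
  have hA' : 0 < A * (1 + |C₀|) ^ k * (1 + max C 0) ^ k := by positivity
  have hC1 : 0 < max C 0 + 1 := by linarith
  -- the viscosity threshold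
  obtain ⟨δ, hδpos, hδ1, hδ2, hδ3, hδ4, hδ5⟩ : ∃ δ : ℝ, 0 < δ ∧ δ ≤ 1 ∧
      δ ≤ ((A * (1 + |C₀|) ^ k * (1 + max C 0) ^ k) ^ 4 * (max C 0 + 1))⁻¹ ∧
      δ ≤ ((A * (1 + |C₀|) ^ k * (1 + max C 0) ^ k) ^ 2 * (max C 0 + 1))⁻¹ ∧
      δ ≤ (ε₀ / (8 * (max C 0 + 1))) ^ 2 ∧ δ ≤ ε₀ / 24 := by
    refine ⟨min (min (min 1 ((A * (1 + |C₀|) ^ k * (1 + max C 0) ^ k) ^ 4 * (max C 0 + 1))⁻¹)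
      (min ((A * (1 + |C₀|) ^ k * (1 + max C 0) ^ k) ^ 2 * (max C 0 + 1))⁻¹ ((ε₀ / (8 * (max C 0 + 1))) ^ 2)))
      (ε₀ / 24), ?_, ?_, ?_, ?_, ?_, ?_⟩
    · exact lt_min (lt_min (lt_min one_pos (by positivity)) (lt_min (by positivity) (by positivity))) (by positivity)
    · exact le_trans (min_le_left _ _) (le_trans (min_le_left _ _) (min_le_left _ _))
    · exact le_trans (min_le_left _ _) (le_trans (min_le_left _ _) (min_le_right _ _))
    · exact le_trans (min_le_left _ _) (le_trans (min_le_right _ _) (min_le_left _ _))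
    · exact le_trans (min_le_left _ _) (le_trans (min_le_right _ _) (min_le_right _ _))
    · exact min_le_right _ _
  obtain ⟨N₁, hN₁⟩ : ∃ N₁ : ℕ, ∀ n', N₁ ≤ n' → ν n' < δ :=
    Filter.eventually_atTop.1 ((tendsto_order.1 hνlim).2 δ hδpos)
  -- the nonresonant subsequence beyond the threshold, with its certified quasi-steady states
  choose n hn w q c hw hq hwd hwm hcC hwE hdiss hres hsup₀ hsup₁ hsup₂ hap using
    fun j : ℕ => hX (max N₁ j)
  have hjn : ∀ j, j ≤ n j := fun j => le_trans (le_max_right _ _) (hn j)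
  have hnδ : ∀ j, ν (n j) < δ := fun j => hN₁ _ (le_trans (le_max_left _ _) (hn j))
  -- realisation at each `j`
  have hreal : ∀ j : ℕ, ∃ (u : 𝕋³ → E³) (p : 𝕋³ → ℝ),
      IsClassicalNSSolutionOn Set.univ (ν (n j)) (fun _ => f) (fun _ => u) (fun _ => p) ∧
        MeasureTheory.integral MeasureTheory.volume (fun x => ‖u x‖ ^ 2) ≤ 2 * E + 2 + (max C 0 + 1) ^ 2 ∧
        ε₀ / 2 ≤ ν (n j) * gradNormSq u :=
    fun j => perStep hP hF1 hF2 hD hA hC'' hCC'' hA' hC1 hε₀ hf hfd hfm (hνpos (n j))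
      (le_trans (hnδ j).le hδ1) (lt_of_lt_of_le (hnδ j) hδ2) (lt_of_lt_of_le (hnδ j) hδ3)
      (lt_of_lt_of_le (hnδ j) hδ4) (lt_of_lt_of_le (hnδ j) hδ5) (hw j) (hq j) (hwd j) (hwm j) (hcC j) (hwE j)
      (hdiss j) (hres j) (hsup₀ j) (hsup₁ j) (hap j)
  choose u p hsol hEn hDis using hreal
  refine ⟨f, hf, hfd, hfm, fun j => ν (n j), u, p, fun j => hνpos (n j), ?_, hsol,
    ⟨2 * E + 2 + (max C 0 + 1) ^ 2, hEn⟩, ε₀ / 2, half_pos hε₀, hDis⟩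
  exact hνlim.comp (tendsto_atTop_mono hjn tendsto_id)

/-- WIRING CHECK: the sorried stubs compose to a closed term of the crux's type (modulo their `sorry`s).
Deliberately an `example` (no constant enters the environment). -/
example : Summit.AnomalousDissipation.AnomalousDissipation.Theses.NeutralTaylorWaves.NewtonRealisation :=
  NewtonRealisation_of stub_borderedFredholm stub_quadraticNewton stub_latticeDictionary stub_aprioriTransfer
    stub_ellipticDensity stub_calculusFacts stub_driftAbsorption

end Summit.AnomalousDissipation.AnomalousDissipation.Cruxes.NewtonRealisation.SketchLine

end
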